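import Summits.NavierStokesRegularity.NavierStokesRegularity.Theses.QuantisedSymmetry
import Literature.Analysis.FluidPDE.TypeIAncientMild
import Literature.Analysis.FluidPDE.ChaeWolfDSSDecayLtNine
import Literature.Analysis.FluidPDE.LerayHopf
import Summits.NavierStokesRegularity.NavierStokesRegularity.Theorems.QuantisedSymmetryPolyhedralDssProfileExistsStubCellConcatenation
import Summits.NavierStokesRegularity.NavierStokesRegularity.Theorems.QuantisedSymmetryPolyhedralDssProfileExistsStubOseenMildOfSlabs
import Summits.NavierStokesRegularity.NavierStokesRegularity.Theorems.QuantisedSymmetryPolyhedralDssProfileExistsStubClassicalOfOseenMildPast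
import Summits.NavierStokesRegularity.NavierStokesRegularity.Theorems.QuantisedSymmetryPolyhedralDssProfileExistsStubDssL4Propagation
import Summits.NavierStokesRegularity.NavierStokesRegularity.Theorems.QuantisedSymmetryPolyhedralDssProfileExistsOfCell
import Summits.NavierStokesRegularity.NavierStokesRegularity.Theorems.QuantisedSymmetryPolyhedralDssProfileExistsNoSmallCell
import Summits.NavierStokesRegularity.NavierStokesRegularity.Theses.Blowup
import Literature.Analysis.FluidPDE.AncientSimilarityVariables
import Literature.Analysis.FluidPDE.BradshawTsaiDSSExistenceHolds
import Summits.NavierStokesRegularity.NavierStokesRegularity.Theorems.QuantisedSymmetryPolyhedralDssProfileExistsLerayOrbitOfProfile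
import Summits.NavierStokesRegularity.NavierStokesRegularity.Theorems.QuantisedSymmetryPolyhedralDssProfileExistsStubSmoothRepresentativeAe
import Summits.NavierStokesRegularity.NavierStokesRegularity.Theorems.QuantisedSymmetryPolyhedralDssProfileExistsStubTransportAe
import Summits.NavierStokesRegularity.NavierStokesRegularity.Theorems.QuantisedSymmetryPolyhedralDssProfileExistsStubCellOfRepresentative
import Summits.NavierStokesRegularity.NavierStokesRegularity.Theorems.QuantisedSymmetryPolyhedralDssProfileExistsStubLerayOrbitOfRepresentative
import Summits.NavierStokesRegularity.NavierStokesRegularity.Theorems.QuantisedSymmetryPolyhedralDssProfileExistsStubSchurJet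
import Summits.NavierStokesRegularity.NavierStokesRegularity.Theorems.QuantisedSymmetryPolyhedralDssProfileExistsCellOfProfile
import Summits.NavierStokesRegularity.NavierStokesRegularity.Theorems.QuantisedSymmetryPolyhedralDssProfileExistsDominatesBlowupProfile
import Summits.NavierStokesRegularity.NavierStokesRegularity.Theorems.QuantisedSymmetryPolyhedralDssProfileExistsStubPeriodWindow
import Summits.NavierStokesRegularity.NavierStokesRegularity.Theorems.QuantisedSymmetryPolyhedralDssProfileExistsStubNoSmallConstant
import Summits.NavierStokesRegularity.NavierStokesRegularity.Theorems.QuantisedSymmetryPolyhedralDssProfileExistsStubSliceNonzero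
import Summits.NavierStokesRegularity.NavierStokesRegularity.Theorems.QuantisedSymmetryPolyhedralDssProfileExistsStubSingularOrigin
import Summits.NavierStokesRegularity.NavierStokesRegularity.Theorems.QuantisedSymmetryPolyhedralDssProfileExistsStubIsotropicMoments
import Summits.NavierStokesRegularity.NavierStokesRegularity.Theorems.QuantisedSymmetryPolyhedralDssProfileExistsStubNoSmallSlice
import Summits.NavierStokesRegularity.NavierStokesRegularity.Theorems.QuantisedSymmetryPolyhedralDssProfileExistsStubNotAxisymmetric
import Summits.NavierStokesRegularity.NavierStokesRegularity.Theorems.QuantisedSymmetryPolyhedralDssProfileExistsStubCentreJet2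
import Summits.NavierStokesRegularity.NavierStokesRegularity.Theorems.QuantisedSymmetryPolyhedralDssProfileExistsStubVorticityEverySlice
import Summits.NavierStokesRegularity.NavierStokesRegularity.Theorems.QuantisedSymmetryPolyhedralDssProfileExistsStubWitnessPortrait
import Summits.NavierStokesRegularity.NavierStokesRegularity.Theorems.QuantisedSymmetryPolyhedralDssProfileExistsStubGaussianEnstrophyIdentity
import Summits.NavierStokesRegularity.NavierStokesRegularity.Theorems.QuantisedSymmetryPolyhedralDssProfileExistsStubEnstrophyFloor
import Summits.NavierStokesRegularity.NavierStokesRegularity.Theorems.QuantisedSymmetryPolyhedralDssProfileExistsStubOrbitBounds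
import Summits.NavierStokesRegularity.NavierStokesRegularity.Theorems.QuantisedSymmetryPolyhedralDssProfileExistsStubHeadPressurePumping
import Summits.NavierStokesRegularity.NavierStokesRegularity.Theorems.QuantisedSymmetryPolyhedralDssProfileExistsStubWitnessPortraitII
import Summits.NavierStokesRegularity.NavierStokesRegularity.Theorems.QuantisedSymmetryPolyhedralDssProfileExistsStubFirstMomentsVanish
import Summits.NavierStokesRegularity.NavierStokesRegularity.Theorems.QuantisedSymmetryPolyhedralDssProfileExistsStubNoLargeScaleNullSlice
import Summits.NavierStokesRegularity.NavierStokesRegularity.Theorems.QuantisedSymmetryPolyhedralDssProfileExistsStubBlowupTrace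
import Summits.NavierStokesRegularity.NavierStokesRegularity.Theorems.QuantisedSymmetryPolyhedralDssProfileExistsStubNoWeakHealing
import Summits.NavierStokesRegularity.NavierStokesRegularity.Theorems.QuantisedSymmetryPolyhedralDssProfileExistsStubAxisAlignment
import Summits.NavierStokesRegularity.NavierStokesRegularity.Theorems.QuantisedSymmetryPolyhedralDssProfileExistsStubAncientDuhamel
import Summits.NavierStokesRegularity.NavierStokesRegularity.Theorems.QuantisedSymmetryPolyhedralDssProfileExistsStubWeightedDivCurl
import Summits.NavierStokesRegularity.NavierStokesRegularity.Theorems.QuantisedSymmetryPolyhedralDssProfileExistsStubDssGroupCyclic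
import Summits.NavierStokesRegularity.NavierStokesRegularity.Theorems.QuantisedSymmetryPolyhedralDssProfileExistsStubTraceWeakLimit
import Summits.NavierStokesRegularity.NavierStokesRegularity.Theorems.QuantisedSymmetryPolyhedralDssProfileExistsStubCurlEquivariant
import Summits.NavierStokesRegularity.NavierStokesRegularity.Theorems.QuantisedSymmetryPolyhedralDssProfileExistsStubZoomLimitIsTrace
import Summits.NavierStokesRegularity.NavierStokesRegularity.Theorems.QuantisedSymmetryPolyhedralDssProfileExistsStubGaussianEnergyIdentity
import Summits.NavierStokesRegularity.NavierStokesRegularity.Theorems.QuantisedSymmetryPolyhedralDssProfileExistsStubWitnessPortraitIII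
import Summits.NavierStokesRegularity.NavierStokesRegularity.Theorems.QuantisedSymmetryPolyhedralDssProfileExistsStubWitnessPortraitIV
import Summits.NavierStokesRegularity.NavierStokesRegularity.Theorems.QuantisedSymmetryPolyhedralDssProfileExistsStubNoEnergyConcentration
import Summits.NavierStokesRegularity.NavierStokesRegularity.Theorems.QuantisedSymmetryPolyhedralDssProfileExistsStubScarCritical
import Summits.NavierStokesRegularity.NavierStokesRegularity.Theorems.QuantisedSymmetryPolyhedralDssProfileExistsStubTraceC1
import Summits.NavierStokesRegularity.NavierStokesRegularity.Theorems.QuantisedSymmetryPolyhedralDssProfileExistsStubWeakDivCurlLiouville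
import Summits.NavierStokesRegularity.NavierStokesRegularity.Theorems.QuantisedSymmetryPolyhedralDssProfileExistsStubTraceCurlWeak
import Summits.NavierStokesRegularity.NavierStokesRegularity.Theorems.QuantisedSymmetryPolyhedralDssProfileExistsStubScarForwardDss
import Summits.NavierStokesRegularity.NavierStokesRegularity.Theorems.QuantisedSymmetryPolyhedralDssProfileExistsStubFarFieldIsTrace

/-!
# Line `polyhedral-cell` for crux `PolyhedralDssProfileExists` (X⁻, stmt-NavierStokesRegularity-1404)
# — route `QuantisedSymmetry`, summit NavierStokesRegularity (negative side); LEAD c14 RESHAPE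

Origin: strategist alternative line `Lines/polyhedral_cell.lean` (cstrat-…-1404-s2, 2026-08-17,
stubs `stub_polyhedralCellExists` [∃-side, XL open] + `stub_cellConcatenatesToDss` [bridge, L]).
The lead (c14) switched the live skeleton from `birth` (parked: its only open stub
`stub_periodicLerayOrbit` is X⁻ itself in Leray variables; its stub 2 landed as p148604) to this line
at the 2026-08-17T09Z turn boundary and RESHAPED the L bridge into four provable, independent stubs
(total 5 ≤ stubs_max 7), keeping the strategist's ∃-stub byte-identical:

* `stub_polyhedralCellExists` (XL, open; unchanged) — a nontrivial `G`-cell with `L⁴` datum.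
* `stub_cellConcatenation` (L; lead) — the two-sided ℤ-concatenation `u(t,x) = c⁻ᵏ v(c⁻²ᵏt, c⁻ᵏx)`
  on the slabs `[-(c²)ᵏ, -(c²)ᵏ⁻¹]`, `k ∈ ℤ` (`u = 0` for `t ≥ 0`): slabwise joint continuity,
  weakly divergence-free slices, the Oseen equation between all pairs of times OF EACH SLAB (zoom
  covariance `oseen_zoom`), exact `c`-DSS, `G`-equivariance, `u(-1) = v(-1)`, and the Type-I time
  rate `‖u(t,x)‖ ≤ M/√(-t)` (scaling of the cell bound).
* `stub_oseenMild_of_slabs` (M; worker) — slabwise continuity + slabwise Oseen equation + a Type-I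
  time rate ⇒ continuity on the open past and the Oseen equation between ALL pairs `s < t < 0`
  (finite chains of slabs, `oseenMild_of_chain`, `continuousOn_uncurry_Ico_of_chain`).
* `stub_dssL4Propagation` (L; worker) — a continuous Oseen-mild field on the past with a Type-I time
  rate, `c`-DSS, with `u(-1) ∈ L⁴`, has all slices in `L⁴` and is `L⁴`-continuous on `(-∞, 0)`
  (Kato's bounded Picard scheme in `L^∞ ∩ L⁴`, `exists_oseen_fixedPoint_bounded`, identified with `u`
  by `oseenMild_bounded_unique`, `continuousInLpOn_oseen_fixedPoint`; DSS scaling across slabs).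
* `stub_classicalOfOseenMildPast` (M/L; worker) — a continuous, weakly divergence-free, Oseen-mild
  field on the past with a Type-I time rate is a classical Navier–Stokes solution on `(-∞, 0)` for
  some pressure (KNSS 2009 Prop. 4.1 `knss2009_smoothing_holds` on windows; `IsTypeIAncientMild`;
  `IsTypeIAncientMild.exists_isClassicalNSSolutionOn_Ioo`; global pressure by
  `exists_isClassicalNSSolutionOn_of_forall_integral_inner_eq_zero`).

Composition `PolyhedralDssProfileExists_of` (kernel-checked, no `sorry`): cell (stub 1) ⇒ `u`
(stubs 2a, 2b) ⇒ classical `(u, p)` (stub 2d) and `C_t L⁴` (stub 2c) ⇒ Type-I space–time bound by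
Chae–Wolf 2017 Thm 1.1 at `q = 4` (`chaeWolf2017_dss_typeI_decay_of_lt_nine`, tree theorem) ⇒
`IsTypeIAncientMild` ⇒ ancient mild in the duality sense with measurable slices; DSS, equivariance and
nontriviality (through `u(-1) = v(-1)`) from stub 2a.

STATE AFTER LEAD c14 (2026-08-17T10:20Z): all four bridge stubs are tree theorems (2a p152125, 2b p151801,
2c p152364, 2d p152134); their assembly is landed as `typeIDss_of_cell` (sector-agnostic) and the
registered reduction `stub_profileOfPolyhedralCell : PolyhedralCellExists-body → crux` (p152884, file
`Theorems/…OfCell.lean`), which the composition below now simply invokes; the strategist's original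
bridge `stub_cellConcatenatesToDss` is landed as a corollary (p153494); and a necessary condition on
witnesses of the one open stub is landed: `stub_noSmallCell` (p153357: an absolute `ε₀ > 0` below which
— in the scale-invariant norm `sup √(-t)|v|` on the model period — every cell is trivial), with
`concat_eq_cell` (the concatenation extends the cell). What remains is EXACTLY the ∃-stub: a nontrivial
polyhedral cell, i.e. the crux's existence content in its cheapest form (open problem).

STATE UNDER LEAD c15 (2026-08-17T12:30Z): the ∃-stub is unchanged (open problem). Lead c15 registered — and ALL ARE NOW LANDED
(A1 p156260, A2 p155960, B p156090, C p155979, D p156249, cellOfProfile p156679, lerayOrbitOfProfile p156993, dominates p156644) — CONVERSE and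
necessary-condition stubs (not hypotheses of the composition; each lands `--supports`): A1
`stub_smoothRepresentative_ae` (duality-form Type-I ancient mild ⇒ Oseen-gauge representative, slice-wise a.e. equal),
A2 `stub_transport_ae` (exact DSS and `G`-equivariance pass to the continuous representative), B
`stub_cellOfRepresentative` (a normalised representative restricts to a `G`-cell with `L⁴` datum), C
`stub_lerayOrbitOfRepresentative` (it is a periodic `G`-equivariant Type-I orbit of the backward Leray system), D
`stub_schurJet` (Schur: an equivariant field has `w(0) = 0` and, if solenoidal, `Dw(0) = 0`), and the lead's assemblies
`stub_cellOfProfile` (crux ⇒ `PolyhedralCellExists`), `stub_lerayOrbitOfProfile` (crux ⇒ periodic Leray orbit), and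
PROVES the domination `blowupTypeIDssProfile_of_polyhedralDssProfileExists` (crux ⇒ `Blowup.BlowupTypeIDssProfile`, stmt-0155). With p152884 and the birth
composition these make `PolyhedralDssProfileExists ↔ PolyhedralCellExists ↔ PeriodicLerayOrbitExists` tree theorems:
the residue is reformulation-invariant and dominated by stmt-0155.

Disproof used: none — no `Disproof.lean` / Negative lemma is filed for this crux (`ledger crux ls`,
2026-08-17T09Z). Known removals honoured (recorded, with proofs in the stub's variables, in the parked
`Lines/birth.lean`): steady profiles (Tsai 1998 / `steadyLerayProfile_eq_zero_of_typeI`), short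
periods `S < S₀(C₀)` i.e. `c < λ₁(C₀)` (Chae–Wolf Thm 1.3, `periodicLerayOrbit_eq_zero_of_period_lt`),
Schur `U(s,0) = 0`; all are constraints on the ∃-stub only.

STATE UNDER LEAD c16 (2026-08-17, 11:45Z–15:30Z): the ∃-stub is unchanged (open problem; certified `↔` the crux by
c15). The payload's three lines (packing-observability, transverse-bloch-emptiness, strain-horn-dichotomy) are again NOT in
`Cruxes/…/Lines/`, not registered, not mounted — ineligible (as for leads c1–c15). Lead c16 RESHAPED by registering
NECESSARY-CONDITION stubs in the crux's own variables `(c, u, C₀)`, resp. for the Oseen-gauge representative `V` and its Leray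
orbit `U = lerayOrbit V` — none is a hypothesis of the composition; each landed `--supports` (three worker waves, 14/14 landed
exactly as registered, + two lead assemblies): N1 `stub_periodWindow` p159657 (Chae–Wolf Thm 1.3 on the crux), N2
`stub_noSmallConstant` p159674 (ε-regularity floor on C₀), N3 `stub_singularOrigin` p159845, N4 `stub_sliceNonzero` p159754,
N5 `stub_noSmallSlice` p160315 (NEW: universal per-slice floor ε₁ on √(-t)‖V(t)‖_∞), N6 `stub_isotropicMoments` p159902 (Schur
on Sym²), N7 `stub_notAxisymmetric` p160737 (KNSS Thm 5.3 on the crux), N8 `stub_centreJet2` p160606 (V, DV, ΔV, ∇p, D²p vanish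
at the centre), N9 `stub_vorticityEverySlice` p160558, N10 `stub_gaussianEnstrophyIdentity` p162020 (+ N10a p161569; NEW: the
Gaussian-weighted period identity ∬w₀|curl U|² = −½∬w₀Π̃(y·U)), N11 `stub_witnessPortrait` p161392 (lead assembly), N12
`stub_orbitBounds` p162679 (PV Lemma 7.1 bounds for every Type-I orbit, normalised pressure), N13 `stub_enstrophyFloor` p162579
(PV Prop 3.1/§7.5 absorption at α = 0: local-enstrophy floor δ₀ on B_{R(C₀)}), N14 `stub_headPressurePumping` p162892 (strict
sign ∬w₀Π̃(y·U) < 0 for nontrivial orbits), N15 `stub_witnessPortraitII` p163727 (lead assembly of N6 N10 N12 N13 N14 on the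
witness's orbit), N16 `stub_firstMomentsVanish` p164773 (Schur on ℝ³⊗ℝ³ + solenoidality: all Gaussian first moments vanish).
ONE sorry remains: the ∃-stub. ∃-side: `Cruxes/…/EVENMAP-PROTOCOL.md` (even-map eigenvector protocol + 1-D calibration).

STATE UNDER LEAD c17 (2026-08-17T14:30Z–): the ∃-stub is unchanged (open problem). The payload's three lines are again
NOT mounted / not in the crux dir / not registered (17th lead). Lead c17 RESHAPE, wave 1: six NECESSARY-CONDITION stubs
(none a hypothesis of the composition; each lands `--supports`): N17 `stub_noLargeScaleNullSlice` (no slice of a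
Type-I ancient mild solution is null at large scales — Albritton–Barker Thm 4.1 `ε = 0`, a TREE THEOREM, applied on
the crux's class), N18 `stub_blowupTrace` (the blow-up-time velocity trace `V₀` exists pointwise on `ℝ³∖{0}`,
continuous, `|V₀| ≤ C₀/|x|`, DSS-homogeneous of degree −1, equivariant), N19 `stub_noWeakHealing` (Type-I classical
solutions whose slices tend weakly to `0` as `t ↑ 0` are trivial — ESS backward uniqueness + unique continuation via
the tree's GKP Step D), N20 `stub_axisAlignment` (equivariant fields are parallel to every rotation axis on the axis),
N21 `stub_ancientDuhamel` (`V = −B_{−∞}(V,V)`: no free part), N22 `stub_weightedDivCurl` (Gaussian div–curl identity;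
with N10 the ENERGY form of the period identity). Lead holds the ∃-stub; assembles the SCAR portrait (trace `V₀ ≢ 0`).
WAVE 1 LANDED 6/6 (N17 p167789, N18 p168727, N19 p167727, N20 p167874, N21 p167665, N22 p168157). WAVE 2 (registered
d8a5dd209c36) LANDED 6/6: N23 `stub_dssGroupCyclic` p169279 (the DSS factors of a witness are exactly `c₀^ℤ` for a minimal
`c₀ ≥ c₁(C₀) > 1`), N25 `stub_traceWeakLimit` p169263 (trace = weak limit, `L¹_loc`, weakly solenoidal), N26
`stub_curlEquivariant` p169415 (vorticity equivariant under proper rotations), N27 `stub_zoomLimitIsTrace` p169227 (along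
`λ = cᵏ` the large-scale limit of every slice is the trace), N28 `stub_gaussianEnergyIdentity` p169298 (energy form of N10:
`∬w₀(P+½|U|²)(y·U) = −2∬w₀|DU|²_F − ∬w₀|U|²`), N24 `stub_witnessPortraitIII` p169435 (lead: the SCAR portrait — `V₀ ≢ 0`).
ONE sorry remains: the ∃-stub (= the crux, open problem).
WAVE 3 (registered 4c26365af817) LANDED 6/6: N29 `stub_traceC1` p170122 (the scar is C¹ off 0, gradients/vorticities converge,
`|x|²|DV₀| ≤ K`), N30 `stub_weakDivCurlLiouville` p169998 (weak div-free + weak curl-free + `|x|⁻¹` envelope ⇒ 0), N31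
`stub_traceCurlWeak` p170209 (weak curl of the scar = pointwise curl), N32 `stub_scarForwardDss` p169703 (the scar is
Bradshaw–Tsai datum: forward c-DSS local Leray continuation), N34 `stub_farFieldIsTrace` p169689 (far field of every slice =
scar), N33 `stub_witnessPortraitIV` p170418 (lead: VORTICITY SCAR `ω₀ = curl V₀ ≢ 0`, equivariant, (−2)-homogeneous, axis
structure, forward continuation). WAVE 4 (registered b5751936be03) LANDED 2/2: N35 `stub_noEnergyConcentration` p170637 (strong
`L²_loc` convergence to the scar, finite local dissipation: no energy concentration), N38 `stub_scarCritical` p170686 (the scar is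
unbounded, `∉ L³(B₁)`, `∈ L^{3,∞} ∩ L²_loc`). 20 files this seat; ONE sorry remains: the ∃-stub (= the crux, open problem).
-/

noncomputable section

namespace Summit.NavierStokesRegularity.NavierStokesRegularity.Cruxes.PolyhedralDssProfileExists.PolyhedralCell

open MeasureTheory Set Function Filter Topology
open Literature.Analysis.FluidPDE
open scoped InnerProductSpace RealInnerProductSpace Laplacian

set_option linter.dupNamespace false

/-! ## The statements of the line (named, so that the composition's hypotheses are keyed by name) -/

/-- **Statement of stub 1 (∃-side): a polyhedral cell with `L⁴` datum exists.** -/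
def PolyhedralCellExists : Prop :=
  ∃ G : Subgroup (EuclideanSpace ℝ (Fin 3) ≃ₗᵢ[ℝ] EuclideanSpace ℝ (Fin 3)), Finite G ∧
    (∀ g ∈ G, LinearMap.det (g.toLinearEquiv : EuclideanSpace ℝ (Fin 3) →ₗ[ℝ] EuclideanSpace ℝ (Fin 3)) = 1) ∧
    (∀ V : Submodule ℝ (EuclideanSpace ℝ (Fin 3)), (∀ g ∈ G, ∀ v ∈ V, g v ∈ V) → V = ⊥ ∨ V = ⊤) ∧
    ∃ c : ℝ, 1 < c ∧ ∃ v : ℝ → EuclideanSpace ℝ (Fin 3) → EuclideanSpace ℝ (Fin 3),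
      (ContinuousOn (Function.uncurry v) (Set.Icc (-1 : ℝ) (-(c ^ 2)⁻¹) ×ˢ Set.univ) ∧
        (∃ M : ℝ, ∀ t ∈ Set.Icc (-1 : ℝ) (-(c ^ 2)⁻¹), ∀ x, ‖v t x‖ ≤ M) ∧
        (∀ t ∈ Set.Icc (-1 : ℝ) (-(c ^ 2)⁻¹), IsWeaklyDivFree (v t)) ∧
        (∀ s t : ℝ, -1 ≤ s → s < t → t ≤ -(c ^ 2)⁻¹ → ∀ x,
          v t x = heatFlow (v s) (t - s) x - oseenDuhamel 1 s v v t x) ∧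
        (∀ x, v (-(c ^ 2)⁻¹) x = c • v (-1) (c • x)) ∧
        (∀ g ∈ G, ∀ t ∈ Set.Icc (-1 : ℝ) (-(c ^ 2)⁻¹), ∀ x, v t (g x) = g (v t x))) ∧
      MemLp (v (-1)) 4 volume ∧ ¬ (v (-1) =ᵐ[volume] 0)

/-- **Statement of stub 2a (concatenation along the zoom).** -/
def CellConcatenation : Prop :=
  ∀ (G : Subgroup (EuclideanSpace ℝ (Fin 3) ≃ₗᵢ[ℝ] EuclideanSpace ℝ (Fin 3))) (c : ℝ), 1 < c →
    ∀ v : ℝ → EuclideanSpace ℝ (Fin 3) → EuclideanSpace ℝ (Fin 3),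
      (ContinuousOn (Function.uncurry v) (Set.Icc (-1 : ℝ) (-(c ^ 2)⁻¹) ×ˢ Set.univ) ∧
        (∃ M : ℝ, ∀ t ∈ Set.Icc (-1 : ℝ) (-(c ^ 2)⁻¹), ∀ x, ‖v t x‖ ≤ M) ∧
        (∀ t ∈ Set.Icc (-1 : ℝ) (-(c ^ 2)⁻¹), IsWeaklyDivFree (v t)) ∧
        (∀ s t : ℝ, -1 ≤ s → s < t → t ≤ -(c ^ 2)⁻¹ → ∀ x,
          v t x = heatFlow (v s) (t - s) x - oseenDuhamel 1 s v v t x) ∧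
        (∀ x, v (-(c ^ 2)⁻¹) x = c • v (-1) (c • x)) ∧
        (∀ g ∈ G, ∀ t ∈ Set.Icc (-1 : ℝ) (-(c ^ 2)⁻¹), ∀ x, v t (g x) = g (v t x))) →
      ∃ u : ℝ → EuclideanSpace ℝ (Fin 3) → EuclideanSpace ℝ (Fin 3),
        (∀ k : ℤ, ContinuousOn (Function.uncurry u)
          (Set.Icc (-((c ^ 2) ^ k)) (-((c ^ 2) ^ (k - 1))) ×ˢ Set.univ)) ∧
        (∀ t < 0, IsWeaklyDivFree (u t)) ∧
        (∀ k : ℤ, ∀ s t : ℝ, -((c ^ 2) ^ k) ≤ s → s < t → t ≤ -((c ^ 2) ^ (k - 1)) → ∀ x,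
          u t x = heatFlow (u s) (t - s) x - oseenDuhamel 1 s u u t x) ∧
        IsDiscretelySelfSimilar c u ∧
        (∀ g ∈ G, ∀ t x, u t (g x) = g (u t x)) ∧
        u (-1) = v (-1) ∧
        (∃ M : ℝ, HasTypeITimeDecay M u)

/-- **Statement of stub 2b (gluing the slabs).** -/
def OseenMildOfSlabs : Prop :=
  ∀ (c : ℝ), 1 < c → ∀ u : ℝ → EuclideanSpace ℝ (Fin 3) → EuclideanSpace ℝ (Fin 3),
    (∀ k : ℤ, ContinuousOn (Function.uncurry u)
      (Set.Icc (-((c ^ 2) ^ k)) (-((c ^ 2) ^ (k - 1))) ×ˢ Set.univ)) →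
    (∃ M : ℝ, HasTypeITimeDecay M u) →
    (∀ k : ℤ, ∀ s t : ℝ, -((c ^ 2) ^ k) ≤ s → s < t → t ≤ -((c ^ 2) ^ (k - 1)) → ∀ x,
      u t x = heatFlow (u s) (t - s) x - oseenDuhamel 1 s u u t x) →
    ContinuousOn (Function.uncurry u) (Set.Iio 0 ×ˢ Set.univ) ∧
      ∀ s t : ℝ, s < t → t < 0 → ∀ x, u t x = heatFlow (u s) (t - s) x - oseenDuhamel 1 s u u t x

/-- **Statement of stub 2c (`L⁴` propagation along a DSS Oseen-mild field).** -/
def DssL4Propagation : Prop :=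
  ∀ (c : ℝ), 1 < c → ∀ (u : ℝ → EuclideanSpace ℝ (Fin 3) → EuclideanSpace ℝ (Fin 3)) (C : ℝ),
    ContinuousOn (Function.uncurry u) (Set.Iio 0 ×ˢ Set.univ) →
    (∀ s t : ℝ, s < t → t < 0 → ∀ x, u t x = heatFlow (u s) (t - s) x - oseenDuhamel 1 s u u t x) →
    HasTypeITimeDecay C u → IsDiscretelySelfSimilar c u → MemLp (u (-1)) 4 volume →
    ContinuousInLpOn (Set.Iio 0) 4 u

/-- **Statement of stub 2d (Oseen-mild on the past ⇒ classical).** -/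
def ClassicalOfOseenMildPast : Prop :=
  ∀ (u : ℝ → EuclideanSpace ℝ (Fin 3) → EuclideanSpace ℝ (Fin 3)) (C : ℝ),
    ContinuousOn (Function.uncurry u) (Set.Iio 0 ×ˢ Set.univ) →
    (∀ t < 0, IsWeaklyDivFree (u t)) →
    (∀ s t : ℝ, s < t → t < 0 → ∀ x, u t x = heatFlow (u s) (t - s) x - oseenDuhamel 1 s u u t x) →
    HasTypeITimeDecay C u →
    ∃ p : ℝ → EuclideanSpace ℝ (Fin 3) → ℝ, IsClassicalNSSolutionOn (Set.Iio 0) 1 0 u p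

namespace Registered

/-- Alias of `PolyhedralCellExists` keyed by the registered stub name. -/
abbrev stub_polyhedralCellExists : Prop := PolyhedralCellExists
/-- Alias of `CellConcatenation` keyed by the registered stub name. -/
abbrev stub_cellConcatenation : Prop := CellConcatenation
/-- Alias of `OseenMildOfSlabs` keyed by the registered stub name. -/
abbrev stub_oseenMild_of_slabs : Prop := OseenMildOfSlabs
/-- Alias of `DssL4Propagation` keyed by the registered stub name. -/
abbrev stub_dssL4Propagation : Prop := DssL4Propagation
/-- Alias of `ClassicalOfOseenMildPast` keyed by the registered stub name. -/
abbrev stub_classicalOfOseenMildPast : Prop := ClassicalOfOseenMildPast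

end Registered

/-! ## Registered stubs (the ONLY `sorry`s of the file; literal signatures) -/

/-- **Stub 1 (XL, open; ∃-side): a polyhedral cell** (strategist's stub, byte-identical). There
are a finite subgroup `G` of the linear isometries of `ℝ³` consisting of rotations and acting
irreducibly (T/O/I up to conjugacy), a factor `c > 1` and a field `v` on the model period
`[-1, -c⁻²] × ℝ³`, jointly continuous, bounded, weakly divergence free, Oseen-mild between all
pairs of model times, closing up under the zoom (`v(-c⁻², x) = c v(-1, cx)`), `G`-equivariant slice
by slice, with datum `v(-1) ∈ L⁴` not a.e. zero. Equivalently: a nontrivial fixed point, with `L⁴`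
tail, of the renormalisation map `𝓡_G = 𝒮_c⁻¹ ∘ Φ_NS(1 − c⁻²)` on bounded continuous `G`-symmetric
solenoidal fields. Why it might fail: the polyhedral Type-I Liouville theorem (route crux #3) or
Tsai's DSS Liouville conjecture may hold; `c < λ₁(C₀)` is removed (Chae–Wolf Thm 1.3), steady cells
are removed (Tsai 1998), small cells are removed (ε-regularity, Chae–Wolf Rem. 1.4); the only
numerics in a polyhedral (octahedral, Kida–Pelz) sector show viscous saturation, not collapse.
[sources: BradshawTsai2017CPDE §1, §5 Open Problem 5.1; ChaeWolf2017RemovingDSS Def. 1.1, Thm 1.1, Thm 1.3, Rem. 1.4; Tsai2018 Conj. 8.8–8.9; KNSS2009 §4; Pelz2001; BoratavPelz1994] -/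
theorem stub_polyhedralCellExists :
    ∃ G : Subgroup (EuclideanSpace ℝ (Fin 3) ≃ₗᵢ[ℝ] EuclideanSpace ℝ (Fin 3)), Finite G ∧
    (∀ g ∈ G, LinearMap.det (g.toLinearEquiv : EuclideanSpace ℝ (Fin 3) →ₗ[ℝ] EuclideanSpace ℝ (Fin 3)) = 1) ∧
    (∀ V : Submodule ℝ (EuclideanSpace ℝ (Fin 3)), (∀ g ∈ G, ∀ v ∈ V, g v ∈ V) → V = ⊥ ∨ V = ⊤) ∧
    ∃ c : ℝ, 1 < c ∧ ∃ v : ℝ → EuclideanSpace ℝ (Fin 3) → EuclideanSpace ℝ (Fin 3),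
      (ContinuousOn (Function.uncurry v) (Set.Icc (-1 : ℝ) (-(c ^ 2)⁻¹) ×ˢ Set.univ) ∧
        (∃ M : ℝ, ∀ t ∈ Set.Icc (-1 : ℝ) (-(c ^ 2)⁻¹), ∀ x, ‖v t x‖ ≤ M) ∧
        (∀ t ∈ Set.Icc (-1 : ℝ) (-(c ^ 2)⁻¹), IsWeaklyDivFree (v t)) ∧
        (∀ s t : ℝ, -1 ≤ s → s < t → t ≤ -(c ^ 2)⁻¹ → ∀ x,
          v t x = heatFlow (v s) (t - s) x - oseenDuhamel 1 s v v t x) ∧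
        (∀ x, v (-(c ^ 2)⁻¹) x = c • v (-1) (c • x)) ∧
        (∀ g ∈ G, ∀ t ∈ Set.Icc (-1 : ℝ) (-(c ^ 2)⁻¹), ∀ x, v t (g x) = g (v t x))) ∧
      MemLp (v (-1)) 4 volume ∧ ¬ (v (-1) =ᵐ[volume] 0) := by
  sorry

/-- **Stub 2a (L; concatenation along the zoom) — LANDED p152125 (lead c14).** Given a `G`-cell `v` on the model period
`[-1, -c⁻²]` (`c > 1`), the two-sided ℤ-concatenation `u(t, x) = c⁻ᵏ v(c⁻²ᵏ t, c⁻ᵏ x)` for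
`t ∈ [-(c²)ᵏ, -(c²)ᵏ⁻¹]`, `k ∈ ℤ` (well defined at the junction times by the zoom condition
`v(-c⁻², x) = c v(-1, cx)`; `u = 0` for `t ≥ 0`) is, slab by slab, jointly continuous
(`continuousOn_zoom_shift`-type composition) and Oseen-mild between all pairs of times of the slab
(zoom covariance `oseen_zoom` with factor `c⁻ᵏ`); its slices are weakly divergence free
(`isWeaklyDivFree_zoom_in`); it is exactly `c`-DSS (`nsRescale c u = u`: the slab index shifts by
one; both sides vanish for `t ≥ 0`), `G`-equivariant at every time (linearity of the isometries and
the slice-wise equivariance of the cell), has `u(-1) = v(-1)` (slab `k = 0` is the cell itself), and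
obeys the Type-I time rate `‖u(t, x)‖ ≤ M/√(-t)` with the cell's bound `M` (on slab `k`,
`‖u‖ ≤ c⁻ᵏ M` and `√(-t) ≤ cᵏ`).
[sources: BradshawTsai2017CPDE §1 (the period map); ChaeWolf2017RemovingDSS Def. 1.1; tree RdssPeriodConcatenation.lean (`oseen_zoom_shift`, `continuousOn_zoom_shift`, `isWeaklyDivFree_zoom_in`), OseenZoomCovariance.lean (`oseen_zoom`)] -/
theorem stub_cellConcatenation :
    ∀ (G : Subgroup (EuclideanSpace ℝ (Fin 3) ≃ₗᵢ[ℝ] EuclideanSpace ℝ (Fin 3))) (c : ℝ), 1 < c →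
    ∀ v : ℝ → EuclideanSpace ℝ (Fin 3) → EuclideanSpace ℝ (Fin 3),
      (ContinuousOn (Function.uncurry v) (Set.Icc (-1 : ℝ) (-(c ^ 2)⁻¹) ×ˢ Set.univ) ∧
        (∃ M : ℝ, ∀ t ∈ Set.Icc (-1 : ℝ) (-(c ^ 2)⁻¹), ∀ x, ‖v t x‖ ≤ M) ∧
        (∀ t ∈ Set.Icc (-1 : ℝ) (-(c ^ 2)⁻¹), IsWeaklyDivFree (v t)) ∧
        (∀ s t : ℝ, -1 ≤ s → s < t → t ≤ -(c ^ 2)⁻¹ → ∀ x,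
          v t x = heatFlow (v s) (t - s) x - oseenDuhamel 1 s v v t x) ∧
        (∀ x, v (-(c ^ 2)⁻¹) x = c • v (-1) (c • x)) ∧
        (∀ g ∈ G, ∀ t ∈ Set.Icc (-1 : ℝ) (-(c ^ 2)⁻¹), ∀ x, v t (g x) = g (v t x))) →
      ∃ u : ℝ → EuclideanSpace ℝ (Fin 3) → EuclideanSpace ℝ (Fin 3),
        (∀ k : ℤ, ContinuousOn (Function.uncurry u)
          (Set.Icc (-((c ^ 2) ^ k)) (-((c ^ 2) ^ (k - 1))) ×ˢ Set.univ)) ∧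
        (∀ t < 0, IsWeaklyDivFree (u t)) ∧
        (∀ k : ℤ, ∀ s t : ℝ, -((c ^ 2) ^ k) ≤ s → s < t → t ≤ -((c ^ 2) ^ (k - 1)) → ∀ x,
          u t x = heatFlow (u s) (t - s) x - oseenDuhamel 1 s u u t x) ∧
        IsDiscretelySelfSimilar c u ∧
        (∀ g ∈ G, ∀ t x, u t (g x) = g (u t x)) ∧
        u (-1) = v (-1) ∧
        (∃ M : ℝ, HasTypeITimeDecay M u) :=
  _root_.Summit.NavierStokesRegularity.NavierStokesRegularity.Theorems.PolyhedralDssProfileExists.PolyhedralCell.stub_cellConcatenation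

/-- **Stub 2b (M; gluing the slabs) — LANDED p151801 (wave 2).** A field on the past which is jointly continuous on every
closed slab `[-(c²)ᵏ, -(c²)ᵏ⁻¹] × ℝ³` (`k ∈ ℤ`, `c > 1`), obeys a Type-I time rate
`‖u(t,x)‖ ≤ M/√(-t)` (so it is bounded on every slab), and satisfies the Oseen integral equation
`u(t) = e^{(t−s)Δ}u(s) − B¹ₛ(u,u)(t)` between all pairs of times of each slab, is jointly continuous
on the open past `(-∞, 0) × ℝ³` and satisfies the Oseen equation between ALL pairs `s < t < 0`: for
`s < t < 0` only the finitely many slabs meeting `[s, t]` matter — reindex them as an increasing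
chain `T n = -(c²)^(K-n)` from some `-(c²)^K ≤ s` and apply the tree's `oseenMild_of_chain`
(induction on junctions with `oseenMild_glue`, KNSS 2009 §4 (4.4)) and
`continuousOn_uncurry_Ico_of_chain`.
[sources: KNSS2009 §4 (4.4); tree OseenMildSlabChain.lean (`oseenMild_glue`, `oseenMild_chain`, `oseenMild_of_chain`, `continuousOn_uncurry_Ico_of_chain`)] -/
theorem stub_oseenMild_of_slabs :
    ∀ (c : ℝ), 1 < c → ∀ u : ℝ → EuclideanSpace ℝ (Fin 3) → EuclideanSpace ℝ (Fin 3),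
      (∀ k : ℤ, ContinuousOn (Function.uncurry u)
        (Set.Icc (-((c ^ 2) ^ k)) (-((c ^ 2) ^ (k - 1))) ×ˢ Set.univ)) →
      (∃ M : ℝ, HasTypeITimeDecay M u) →
      (∀ k : ℤ, ∀ s t : ℝ, -((c ^ 2) ^ k) ≤ s → s < t → t ≤ -((c ^ 2) ^ (k - 1)) → ∀ x,
        u t x = heatFlow (u s) (t - s) x - oseenDuhamel 1 s u u t x) →
      ContinuousOn (Function.uncurry u) (Set.Iio 0 ×ˢ Set.univ) ∧
        ∀ s t : ℝ, s < t → t < 0 → ∀ x,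
          u t x = heatFlow (u s) (t - s) x - oseenDuhamel 1 s u u t x :=
  _root_.Summit.NavierStokesRegularity.NavierStokesRegularity.Theorems.PolyhedralDssProfileExists.PolyhedralCell.stub_oseenMild_of_slabs

/-- **Stub 2c (L; `L⁴` propagation along a DSS Oseen-mild field) — LANDED p152364 (wave 2).** A field `u` on the past which
is jointly continuous on `(-∞, 0) × ℝ³`, satisfies the Oseen integral equation between all pairs
`s < t < 0`, obeys a Type-I time rate `‖u(t,x)‖ ≤ C/√(-t)`, is exactly `c`-DSS (`c > 1`) and has
`u(-1) ∈ L⁴(ℝ³)`, has every slice `u(t)`, `t < 0`, in `L⁴` and is `L⁴`-continuous on `(-∞, 0)`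
(`ContinuousInLpOn (Iio 0) 4 u`). Proof route: on a short window `(s, s + δ)` (δ depending only on
the sup bound of `u` there) Kato's bounded Picard scheme in `L^∞ ∩ L⁴`
(`exists_oseen_fixedPoint_bounded` with `p = 4`, datum `u(s) ∈ L^∞ ∩ L⁴`) produces a bounded solution
of the same Oseen equation with slices in `L⁴` and `C_t L⁴` (`continuousInLpOn_oseen_fixedPoint`),
which coincides with `u` a.e. slice-wise by uniqueness of bounded solutions
(`oseenMild_bounded_unique`), hence everywhere (both continuous); a real induction over `[-1, T₁]`,
`T₁ < 0` (`forall_Icc_of_local_propagation`-style) gives `L⁴` slices and continuity on `[-1, 0)`;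
the exact self-similarity `u(t, x) = c u(c²t, cx)` (`‖u(t)‖_{L⁴} = c^{1/4} ‖u(c²t)‖_{L⁴}`) carries
both to `(-∞, -1]`.
[sources: LemarieRieusset2016 Thm 5.1, Thm 7.5, Thm 9.12; KNSS2009 §4 (4.3)–(4.4); tree KatoLocalBoundedPicard.lean, KatoLocalBoundedContinuity.lean, OseenMildUniqueness.lean, HeatFlowLpClass.lean] -/
theorem stub_dssL4Propagation :
    ∀ (c : ℝ), 1 < c → ∀ (u : ℝ → EuclideanSpace ℝ (Fin 3) → EuclideanSpace ℝ (Fin 3)) (C : ℝ),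
      ContinuousOn (Function.uncurry u) (Set.Iio 0 ×ˢ Set.univ) →
      (∀ s t : ℝ, s < t → t < 0 → ∀ x,
        u t x = heatFlow (u s) (t - s) x - oseenDuhamel 1 s u u t x) →
      HasTypeITimeDecay C u → IsDiscretelySelfSimilar c u → MemLp (u (-1)) 4 volume →
      ContinuousInLpOn (Set.Iio 0) 4 u :=
  _root_.Summit.NavierStokesRegularity.NavierStokesRegularity.Theorems.PolyhedralDssProfileExists.PolyhedralCell.stub_dssL4Propagation

/-- **Stub 2d (M/L; Oseen-mild on the past ⇒ classical) — LANDED p152134 (wave 2).** A field `u` on the past which is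
jointly continuous on `(-∞, 0) × ℝ³`, has weakly divergence-free slices, satisfies the Oseen
integral equation `u(t) = e^{(t−s)Δ}u(s) − B¹ₛ(u,u)(t)` between all pairs `s < t < 0`, and obeys a
Type-I time rate `‖u(t,x)‖ ≤ C/√(-t)`, is a classical solution of the unforced Navier–Stokes system
(`ν = 1`) on `(-∞, 0)` for some smooth pressure. Proof route: on each window `(s, T₁)`,
`s < T₁ < 0`, the slices are bounded by `C/√(-T₁)` and `u` IS the canonical representative
`e^{(t−s)Δ}u(s) − B¹ₛ(u,u)(t)`, which KNSS 2009 Prop. 4.1 (`knss2009_smoothing_holds`) makes jointly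
`C^∞`; so `u` is smooth on the open past, its slices are divergence free pointwise
(`IsWeaklyDivFree.isDivFree_of_contDiff`), `u ∈ IsTypeIAncientMild C u`, hence classical on every
window `(t₀, 0)` (`IsTypeIAncientMild.exists_isClassicalNSSolutionOn_Ioo`), and the momentum equation
tested against solenoidal fields at each `t < 0` yields ONE pressure on `(-∞, 0)`
(`exists_isClassicalNSSolutionOn_of_forall_integral_inner_eq_zero`, as in
`classical_of_bounded_mild_L3_of_knss2009_smoothing`).
[sources: KNSS2009 Prop. 4.1, Rem. 4.1; FabesJonesRiviere1972 Thm 2.1; tree KNSSSmoothingHolds.lean, TypeIAncientMildClassical.lean, PressureReconstruction.lean, MildL3SmoothOfKNSS.lean] -/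
theorem stub_classicalOfOseenMildPast :
    ∀ (u : ℝ → EuclideanSpace ℝ (Fin 3) → EuclideanSpace ℝ (Fin 3)) (C : ℝ),
      ContinuousOn (Function.uncurry u) (Set.Iio 0 ×ˢ Set.univ) →
      (∀ t < 0, IsWeaklyDivFree (u t)) →
      (∀ s t : ℝ, s < t → t < 0 → ∀ x,
        u t x = heatFlow (u s) (t - s) x - oseenDuhamel 1 s u u t x) →
      HasTypeITimeDecay C u →
      ∃ p : ℝ → EuclideanSpace ℝ (Fin 3) → ℝ, IsClassicalNSSolutionOn (Set.Iio 0) 1 0 u p :=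
  _root_.Summit.NavierStokesRegularity.NavierStokesRegularity.Theorems.PolyhedralDssProfileExists.PolyhedralCell.stub_classicalOfOseenMildPast

/-! ## Converse and necessary-condition stubs (lead c15; registered; NOT hypotheses of the composition)

These run the reduction BACKWARDS (crux ⇒ cell, crux ⇒ periodic Leray orbit) and record what a witness must
satisfy. Every one is a theorem to be proved as stated and landed `--supports stmt-NavierStokesRegularity-1404`. -/

/-- **Stub A1 (L): the Oseen-gauge representative, with slice-wise a.e. equality.** An ancient mild
solution in the tree's duality form (`IsAncientMildSolution 1 u`) with measurable slices and the Type-I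
space–time bound `‖u(t,x)‖ ≤ C₀/(‖x‖ + √(−t))` is, slice by slice almost everywhere, a field `V` of the KNSS
Oseen gauge `IsTypeIAncientMild C V` (jointly `C^∞` on the open past, divergence free, Oseen integral
equation between all pairs `s < t < 0`, `‖V‖ ≤ C/√(−t)`), which still obeys the Type-I space–time bound with
the same `C₀` (a closed condition along a.e. equality of a continuous slice) and is normalised to `0` on
`t ≥ 0`. Proof route = steps (1)–(3) of the landed `Theorems.stub_rdssSmoothRepresentative`
(`FilamentSkeletonRssRdssProfileTruncationSmoothRepresentative.lean`; no self-similarity is needed): weak-*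
continuity in time from the decay, jointly measurable modification
(`exists_stronglyMeasurable_modification`), bounded weak translates
(`IsBoundedAncientMildSolution.isBoundedWeakNSSolutionOn`), Morrey bound from `‖u‖ ≤ C₀/‖x‖`, window
representatives (`HardyAncientLimit.exists_oseenMild_repr_of_boundedWeak`) glued along exhausting windows,
KNSS Prop. 4.1 (`isTypeIAncientMild_of_continuous_oseenMild`); the a.e. equality for EVERY `t < 0` from the
space–time a.e. equality, the weak-* continuity of `u` and the continuity of `V` (test against `θ`, du
Bois-Reymond). [sources: KNSS2009 Lemma 3.1, Prop. 4.1, §6; SereginSverak2009 (1.1); tree files named] -/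
theorem stub_smoothRepresentative_ae :
    ∀ (u : ℝ → EuclideanSpace ℝ (Fin 3) → EuclideanSpace ℝ (Fin 3)) (C₀ : ℝ),
      IsAncientMildSolution 1 u → (∀ t < 0, AEStronglyMeasurable (u t) volume) → HasTypeIDecay C₀ u →
      ∃ (V : ℝ → EuclideanSpace ℝ (Fin 3) → EuclideanSpace ℝ (Fin 3)) (C : ℝ),
        IsTypeIAncientMild C V ∧ HasTypeIDecay C₀ V ∧ (∀ t < 0, V t =ᵐ[volume] u t) ∧
        (∀ t, 0 ≤ t → V t = 0) :=
  -- LANDED p156260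
  _root_.Summit.NavierStokesRegularity.NavierStokesRegularity.Theorems.PolyhedralDssProfileExists.PolyhedralCell.stub_smoothRepresentative_ae

/-- **Stub A2 (M): exact self-similarity and equivariance pass to the continuous representative.** If `u`
is exactly `c`-DSS (`nsRescale c u = u`) and `G`-equivariant at every time, and `V` is an Oseen-gauge field
(`IsTypeIAncientMild C V`, so its negative slices are continuous) with `V t = u t` a.e. for every `t < 0`
and `V t = 0` for `t ≥ 0`, then `V` is exactly `c`-DSS and `G`-equivariant at every time: on a negative
slice both `x ↦ c • V (c²t) (c • x)` and `V t` (resp. `V t ∘ g` and `g ∘ V t`) are continuous and agree a.e.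
— the linear automorphisms `x ↦ c • x` (`c ≠ 0`) and the isometries `g` preserve Lebesgue-null sets
(`Measure.map_linearMap_addHaar_eq_smul_addHaar` / `LinearIsometryEquiv.measurePreserving`) — hence agree
everywhere (`Continuous.ae_eq_iff_eq`); on `t ≥ 0` both sides vanish (`c² t ≥ 0`, `g 0 = 0`).
[sources: ChaeWolf2017RemovingDSS Def. 1.1; tree `rdssRepr_ae_comp` pattern in FilamentSkeletonRssRdssProfileTruncationSmoothRepresentative.lean] -/
theorem stub_transport_ae :
    ∀ (G : Subgroup (EuclideanSpace ℝ (Fin 3) ≃ₗᵢ[ℝ] EuclideanSpace ℝ (Fin 3))) (c : ℝ)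
      (u V : ℝ → EuclideanSpace ℝ (Fin 3) → EuclideanSpace ℝ (Fin 3)) (C : ℝ), 1 < c →
      IsDiscretelySelfSimilar c u → (∀ g ∈ G, ∀ t x, u t (g x) = g (u t x)) →
      IsTypeIAncientMild C V → (∀ t < 0, V t =ᵐ[volume] u t) → (∀ t, 0 ≤ t → V t = 0) →
      IsDiscretelySelfSimilar c V ∧ (∀ g ∈ G, ∀ t x, V t (g x) = g (V t x)) :=
  -- LANDED p155960
  _root_.Summit.NavierStokesRegularity.NavierStokesRegularity.Theorems.PolyhedralDssProfileExists.PolyhedralCell.stub_transport_ae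

/-- **Stub B (M): a normalised Oseen-gauge profile restricts to a `G`-cell with `L⁴` datum.** Let `V` be an
Oseen-gauge Type-I field (`IsTypeIAncientMild C V`), exactly `c`-DSS (`c > 1`), with the space–time bound
`HasTypeIDecay C₀ V`, `G`-equivariant, and nonzero at some `(t₀, x₀)`, `t₀ < 0`. Then the parabolic
rescaling `v = nsRescale √(−t₀) V` (tree: `isTypeIAncientMild_nsRescale`, `HasTypeIDecay.nsRescale`,
`nsRescale_mul` for the DSS, linearity of `g` for equivariance) restricted to the model period
`[-1, -c⁻²] × ℝ³` is a cell: jointly continuous (`IsTypeIAncientMild.continuousOn_uncurry`), bounded by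
`C·c` (`.norm_le`, `√(−t) ≥ c⁻¹`, `.nonneg`), weakly divergence free (`.isWeaklyDivFree`), Oseen-mild between
model times (`.mild_eq`), closing up under the zoom (the DSS identity at `t = −c⁻²`), `G`-equivariant; its
datum `v(−1)` is continuous with `‖v(−1,x)‖ ≤ C₀/(‖x‖+1)`, hence in `L⁴(ℝ³)` (`integrable_one_add_norm`,
exponent `4 > 3`), and `v(−1)(√(−t₀)⁻¹ x₀) = √(−t₀) V t₀ x₀ ≠ 0`, so `v(−1)` is not a.e. zero (continuous).
[sources: BradshawTsai2017CPDE §1 (period map); KNSS2009 §4; tree FilamentSkeletonRssRdssProfileTruncationRescale.lean] -/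
theorem stub_cellOfRepresentative :
    ∀ (G : Subgroup (EuclideanSpace ℝ (Fin 3) ≃ₗᵢ[ℝ] EuclideanSpace ℝ (Fin 3))) (c : ℝ)
      (V : ℝ → EuclideanSpace ℝ (Fin 3) → EuclideanSpace ℝ (Fin 3)) (C C₀ t₀ : ℝ)
      (x₀ : EuclideanSpace ℝ (Fin 3)),
      1 < c → IsTypeIAncientMild C V → IsDiscretelySelfSimilar c V → HasTypeIDecay C₀ V →
      (∀ g ∈ G, ∀ t x, V t (g x) = g (V t x)) → t₀ < 0 → V t₀ x₀ ≠ 0 →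
      ∃ v : ℝ → EuclideanSpace ℝ (Fin 3) → EuclideanSpace ℝ (Fin 3),
        (ContinuousOn (Function.uncurry v) (Set.Icc (-1 : ℝ) (-(c ^ 2)⁻¹) ×ˢ Set.univ) ∧
          (∃ M : ℝ, ∀ t ∈ Set.Icc (-1 : ℝ) (-(c ^ 2)⁻¹), ∀ x, ‖v t x‖ ≤ M) ∧
          (∀ t ∈ Set.Icc (-1 : ℝ) (-(c ^ 2)⁻¹), IsWeaklyDivFree (v t)) ∧
          (∀ s t : ℝ, -1 ≤ s → s < t → t ≤ -(c ^ 2)⁻¹ → ∀ x,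
            v t x = heatFlow (v s) (t - s) x - oseenDuhamel 1 s v v t x) ∧
          (∀ x, v (-(c ^ 2)⁻¹) x = c • v (-1) (c • x)) ∧
          (∀ g ∈ G, ∀ t ∈ Set.Icc (-1 : ℝ) (-(c ^ 2)⁻¹), ∀ x, v t (g x) = g (v t x))) ∧
        MemLp (v (-1)) 4 volume ∧ ¬ (v (-1) =ᵐ[volume] 0) :=
  -- LANDED p156090
  _root_.Summit.NavierStokesRegularity.NavierStokesRegularity.Theorems.PolyhedralDssProfileExists.PolyhedralCell.stub_cellOfRepresentative

/-- **Stub C (M): a normalised Oseen-gauge profile is a periodic `G`-equivariant Type-I orbit of the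
backward Leray system.** With `V` as in stub B, the similarity profile `U = lerayOrbit V`,
`P = lerayOrbitPressure p` — `p` a pressure making `V` classical on the past
(`PolyhedralCell.exists_isClassicalNSSolutionOn_Iio_of_isTypeIAncientMild`, p152134) — solves the backward
Leray system on `ℝ × ℝ³` (`isClassicalNSSolutionOn_Iio_iff_isBackwardLeraySolutionOn`), is
`2 log c`-periodic (`IsDiscretelySelfSimilar.periodic_lerayOrbit`), obeys the profile bound
`(1 + ‖y‖)‖U(s,y)‖ ≤ C₀` (`hasTypeIDecay_iff_lerayOrbit`), is `G`-equivariant (linearity of `g` through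
`lerayOrbit_apply`) and is nonzero at `s = −log(−t₀)`, `y = √(−t₀)⁻¹ x₀` (`lerayOrbit_neg_log`).
[sources: ChaeWolf2017RemovingDSS §4; BradshawTsai2017CPDE §5; tree AncientSimilarityVariables.lean] -/
theorem stub_lerayOrbitOfRepresentative :
    ∀ (G : Subgroup (EuclideanSpace ℝ (Fin 3) ≃ₗᵢ[ℝ] EuclideanSpace ℝ (Fin 3))) (c : ℝ)
      (V : ℝ → EuclideanSpace ℝ (Fin 3) → EuclideanSpace ℝ (Fin 3)) (C C₀ t₀ : ℝ)
      (x₀ : EuclideanSpace ℝ (Fin 3)),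
      1 < c → IsTypeIAncientMild C V → IsDiscretelySelfSimilar c V → HasTypeIDecay C₀ V →
      (∀ g ∈ G, ∀ t x, V t (g x) = g (V t x)) → t₀ < 0 → V t₀ x₀ ≠ 0 →
      ∃ (U : ℝ → EuclideanSpace ℝ (Fin 3) → EuclideanSpace ℝ (Fin 3))
        (P : ℝ → EuclideanSpace ℝ (Fin 3) → ℝ),
        IsBackwardLeraySolutionOn univ 1 U P ∧ Function.Periodic U (2 * Real.log c) ∧
        (∀ s y, (1 + ‖y‖) * ‖U s y‖ ≤ C₀) ∧
        (∀ g ∈ G, ∀ s y, U s (g y) = g (U s y)) ∧ (∃ s y, U s y ≠ 0) :=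
  -- LANDED p155979
  _root_.Summit.NavierStokesRegularity.NavierStokesRegularity.Theorems.PolyhedralDssProfileExists.PolyhedralCell.stub_lerayOrbitOfRepresentative

/-- **Stub D (M): the Schur jet at the centre.** If `G` acts irreducibly on `ℝ³` (every `G`-invariant
subspace is `⊥` or `⊤`) and `w : ℝ³ → ℝ³` is `G`-equivariant, then `w(0) = 0` (a `G`-fixed vector spans an
invariant line), and if moreover `w` is differentiable at `0` with `div w(0) = 0` then `Dw(0) = 0`: the
derivative `A = Dw(0)` commutes with `G` (chain rule, `g` linear, `g 0 = 0`); its symmetric part has a real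
eigenvalue whose eigenspace is invariant, hence is a scalar `μ`; its skew part `K` commutes with `G`, and
`K² = −KᵀK` is a non-positive symmetric scalar `−ν`; `ν > 0` would give `det(K)² = det(−ν·1) = −ν³ < 0`, so
`K = 0`; thus `A = μ·1` and `tr A = div w(0) = 0` forces `μ = 0`. For a witness of the crux (continuous
representative, stub A1/A2) this is the thesis' `u(0,t) = 0`, `∇u(0,t) = 0`: the singular point is a
degenerate stagnation point of every slice. [sources: route thesis (Schur); Serre, Linear Representations of Finite Groups §13.2 (real Schur); folklore] -/
theorem stub_schurJet :
    ∀ (G : Subgroup (EuclideanSpace ℝ (Fin 3) ≃ₗᵢ[ℝ] EuclideanSpace ℝ (Fin 3))),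
      (∀ V : Submodule ℝ (EuclideanSpace ℝ (Fin 3)), (∀ g ∈ G, ∀ v ∈ V, g v ∈ V) → V = ⊥ ∨ V = ⊤) →
      ∀ w : EuclideanSpace ℝ (Fin 3) → EuclideanSpace ℝ (Fin 3), (∀ g ∈ G, ∀ x, w (g x) = g (w x)) →
        w 0 = 0 ∧ (DifferentiableAt ℝ w 0 → VectorCalculus.divergence w 0 = 0 → fderiv ℝ w 0 = 0) :=
  -- LANDED p156249
  _root_.Summit.NavierStokesRegularity.NavierStokesRegularity.Theorems.PolyhedralDssProfileExists.PolyhedralCell.stub_schurJet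

/-- **Stub (lead; assembly of A1, A2, B): the crux yields a polyhedral cell** — the converse of the landed
reduction `stub_profileOfPolyhedralCell` (p152884), so that `PolyhedralDssProfileExists ↔ PolyhedralCellExists`. -/
theorem stub_cellOfProfile :
    _root_.Summit.NavierStokesRegularity.NavierStokesRegularity.Theses.QuantisedSymmetry.PolyhedralDssProfileExists →
      ∃ G : Subgroup (EuclideanSpace ℝ (Fin 3) ≃ₗᵢ[ℝ] EuclideanSpace ℝ (Fin 3)), Finite G ∧
      (∀ g ∈ G, LinearMap.det (g.toLinearEquiv : EuclideanSpace ℝ (Fin 3) →ₗ[ℝ] EuclideanSpace ℝ (Fin 3)) = 1) ∧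
      (∀ V : Submodule ℝ (EuclideanSpace ℝ (Fin 3)), (∀ g ∈ G, ∀ v ∈ V, g v ∈ V) → V = ⊥ ∨ V = ⊤) ∧
      ∃ c : ℝ, 1 < c ∧ ∃ v : ℝ → EuclideanSpace ℝ (Fin 3) → EuclideanSpace ℝ (Fin 3),
        (ContinuousOn (Function.uncurry v) (Set.Icc (-1 : ℝ) (-(c ^ 2)⁻¹) ×ˢ Set.univ) ∧
          (∃ M : ℝ, ∀ t ∈ Set.Icc (-1 : ℝ) (-(c ^ 2)⁻¹), ∀ x, ‖v t x‖ ≤ M) ∧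
          (∀ t ∈ Set.Icc (-1 : ℝ) (-(c ^ 2)⁻¹), IsWeaklyDivFree (v t)) ∧
          (∀ s t : ℝ, -1 ≤ s → s < t → t ≤ -(c ^ 2)⁻¹ → ∀ x,
            v t x = heatFlow (v s) (t - s) x - oseenDuhamel 1 s v v t x) ∧
          (∀ x, v (-(c ^ 2)⁻¹) x = c • v (-1) (c • x)) ∧
          (∀ g ∈ G, ∀ t ∈ Set.Icc (-1 : ℝ) (-(c ^ 2)⁻¹), ∀ x, v t (g x) = g (v t x))) ∧
        MemLp (v (-1)) 4 volume ∧ ¬ (v (-1) =ᵐ[volume] 0) :=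
  -- LANDED p156679
  _root_.Summit.NavierStokesRegularity.NavierStokesRegularity.Theorems.PolyhedralDssProfileExists.PolyhedralCell.stub_cellOfProfile

/-- **Stub (lead; assembly of A1, A2, C): the crux yields a periodic polyhedrally-equivariant Type-I orbit of
the backward Leray system** — the converse of the birth composition, so that
`PolyhedralDssProfileExists ↔ PeriodicLerayOrbitExists` (the body below is `Birth.PeriodicLerayOrbitExists`). -/
theorem stub_lerayOrbitOfProfile :
    _root_.Summit.NavierStokesRegularity.NavierStokesRegularity.Theses.QuantisedSymmetry.PolyhedralDssProfileExists →
      ∃ G : Subgroup (EuclideanSpace ℝ (Fin 3) ≃ₗᵢ[ℝ] EuclideanSpace ℝ (Fin 3)), Finite G ∧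
      (∀ g ∈ G, LinearMap.det (g.toLinearEquiv : EuclideanSpace ℝ (Fin 3) →ₗ[ℝ] EuclideanSpace ℝ (Fin 3)) = 1) ∧
      (∀ V : Submodule ℝ (EuclideanSpace ℝ (Fin 3)), (∀ g ∈ G, ∀ v ∈ V, g v ∈ V) → V = ⊥ ∨ V = ⊤) ∧
      ∃ S : ℝ, 0 < S ∧ ∃ (U : ℝ → EuclideanSpace ℝ (Fin 3) → EuclideanSpace ℝ (Fin 3))
        (P : ℝ → EuclideanSpace ℝ (Fin 3) → ℝ),
        IsBackwardLeraySolutionOn univ 1 U P ∧ Function.Periodic U S ∧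
        (∃ C₀ : ℝ, ∀ s y, (1 + ‖y‖) * ‖U s y‖ ≤ C₀) ∧
        (∀ g ∈ G, ∀ s y, U s (g y) = g (U s y)) ∧ (∃ s y, U s y ≠ 0) :=
  -- LANDED p156993
  _root_.Summit.NavierStokesRegularity.NavierStokesRegularity.Theorems.PolyhedralDssProfileExists.PolyhedralCell.stub_lerayOrbitOfProfile

/-- **Domination (lead c15, proved): the crux implies `Blowup.BlowupTypeIDssProfile`**
(stmt-NavierStokesRegularity-0155, `¬ ∀ λ, TypeIDSSLiouville λ ∧ ∀ R, RotatedTypeIDSSLiouville λ R`): a polyhedral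
profile is in particular a Type-I `λ`-DSS ancient mild profile with measurable slices, which `TypeIDSSLiouville λ`
would annihilate on every slice. After the cone change (bridge #4 proved for every profile) the `G`-clauses are
load-bearing nowhere on the summit path; this records the domination X ⇒ 0155. -/
theorem blowupTypeIDssProfile_of_polyhedralDssProfileExists
    (hX : _root_.Summit.NavierStokesRegularity.NavierStokesRegularity.Theses.QuantisedSymmetry.PolyhedralDssProfileExists) :
    _root_.Summit.NavierStokesRegularity.NavierStokesRegularity.Theses.Blowup.BlowupTypeIDssProfile := by
  obtain ⟨G, -, -, -, c, hc, u, hanc, hmeas, hdss, hdec, -, hnt⟩ := hX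
  dsimp only [_root_.Summit.NavierStokesRegularity.NavierStokesRegularity.Theses.Blowup.BlowupTypeIDssProfile]
  intro hL
  exact hnt ((hL c).1 hc u hanc hmeas hdss hdec)


/-- **Stub (lead; domination, registered copy of `blowupTypeIDssProfile_of_polyhedralDssProfileExists` above so that
its proof file lands `--supports`): the crux implies `Blowup.BlowupTypeIDssProfile`** (stmt-NavierStokesRegularity-0155). -/
theorem stub_dominatesBlowupProfile :
    _root_.Summit.NavierStokesRegularity.NavierStokesRegularity.Theses.QuantisedSymmetry.PolyhedralDssProfileExists →
      _root_.Summit.NavierStokesRegularity.NavierStokesRegularity.Theses.Blowup.BlowupTypeIDssProfile :=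
  -- LANDED p156644
  _root_.Summit.NavierStokesRegularity.NavierStokesRegularity.Theorems.PolyhedralDssProfileExists.PolyhedralCell.stub_dominatesBlowupProfile

/-! ## Registered necessary-condition stubs of lead c16 (N1–N6; sorried until their files land `--supports`)

Each is stated in the crux's own variables — the duality-form profile `u` with its factor `c` and Type-I
constant `C₀`, exactly the clauses of `QuantisedSymmetry.PolyhedralDssProfileExists` minus the group (the
removals N1, N2, N4 are symmetry-free) — or for the Oseen-gauge representative `V` of a witness
(`IsTypeIAncientMild C V`, produced by the landed stub A1 and transported by A2). None feeds the composition. -/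

/-- **Stub N1 (M; worker): the period window on the crux (Chae–Wolf 2017, Thm 1.3).** For every `C₀ > 0`
there is `c₁ > 1` such that every ancient mild solution `u` (duality form, measurable slices) which is
exactly `c`-DSS with `1 < c < c₁` and obeys the Type-I bound `‖u(t,x)‖ ≤ C₀/(‖x‖ + √(-t))` has all its
negative slices a.e. zero. Hence every witness `(G, c, u)` of the crux with constant `C₀` has `c ≥ c₁(C₀)`.
Proof route: Oseen-gauge representative `V` (`stub_smoothRepresentative_ae`, p156260: `IsTypeIAncientMild C V`,
`HasTypeIDecay C₀ V`, `V t =ᵐ u t`), exact DSS passes to `V` (`stub_transport_ae` with `G = ⊥`, p155960),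
`V` is classical on the past for some pressure (`exists_isClassicalNSSolutionOn_Iio_of_isTypeIAncientMild`,
p152134), and the DISCHARGED fact `chaeWolf2017_removing_dss_holds` kills `V`; `u t =ᵐ V t = 0`.
[sources: ChaeWolf2017RemovingDSS Thm 1.3 (arXiv:1610.09464 p. 3); tree `chaeWolf2017_removing_dss_holds`] -/
theorem stub_periodWindow :
    ∀ C₀ : ℝ, 0 < C₀ → ∃ c₁ : ℝ, 1 < c₁ ∧
      ∀ (c : ℝ) (u : ℝ → EuclideanSpace ℝ (Fin 3) → EuclideanSpace ℝ (Fin 3)), 1 < c → c < c₁ →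
        IsAncientMildSolution 1 u → (∀ t < 0, AEStronglyMeasurable (u t) volume) →
        IsDiscretelySelfSimilar c u → HasTypeIDecay C₀ u → ∀ t < 0, u t =ᵐ[volume] 0 :=
  -- LANDED p159657 (lead c16, wave 1)
  _root_.Summit.NavierStokesRegularity.NavierStokesRegularity.Theorems.PolyhedralDssProfileExists.PolyhedralCell.stub_periodWindow

/-- **Stub N2 (M; worker): no small Type-I constant on the crux (Gustafson–Kang–Tsai ε-regularity /
Chae–Wolf 2017 Rem. 1.4 and proof of Thm 1.3, Step 1).** There is an absolute `ε > 0` such that every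
ancient mild solution `u` (duality form, measurable slices) with a Type-I bound of constant `C₀ ≤ ε` has all
its negative slices a.e. zero (no self-similarity and no symmetry needed). Hence every witness of the crux has
`C₀ > ε`. Proof route: representative `V` (`stub_smoothRepresentative_ae`), classical pressure
(`exists_isClassicalNSSolutionOn_Iio_of_isTypeIAncientMild`), `√(-t)‖V(t,x)‖ ≤ C₀ ≤ ε₀` from
`HasTypeIDecay C₀ V`, and `ChaeWolf.exists_eps_typeI_small_eq_zero` (tree); a negative `C₀` is vacuous
(`HasTypeIDecay C₀ u` at `(t,x) = (-1,0)` forces `0 ≤ C₀`).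
[sources: ChaeWolf2017RemovingDSS Rem. 1.4, §3 Step 1 (arXiv:1610.09464 pp. 3, 8); GustafsonKangTsai2007; tree `ChaeWolf.exists_eps_typeI_small_eq_zero`] -/
theorem stub_noSmallConstant :
    ∃ ε : ℝ, 0 < ε ∧ ∀ (u : ℝ → EuclideanSpace ℝ (Fin 3) → EuclideanSpace ℝ (Fin 3)) (C₀ : ℝ),
      IsAncientMildSolution 1 u → (∀ t < 0, AEStronglyMeasurable (u t) volume) →
      HasTypeIDecay C₀ u → C₀ ≤ ε → ∀ t < 0, u t =ᵐ[volume] 0 :=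
  -- LANDED p159674 (lead c16, wave 1)
  _root_.Summit.NavierStokesRegularity.NavierStokesRegularity.Theorems.PolyhedralDssProfileExists.PolyhedralCell.stub_noSmallConstant

/-- **Stub N3 (S; worker): the origin is a genuine singular point.** A field `V` which is exactly `c`-DSS
(`c > 1`) and nonzero at one point `(t₀, x₀)` of the past is unbounded in every parabolic cylinder
`Q_r = (-r², 0) × B_r(0)`: the zoom images `(c⁻²ᵏ t₀, c⁻ᵏ x₀)`, `k → ∞`, enter `Q_r` and carry the values
`‖V(c⁻²ᵏt₀, c⁻ᵏx₀)‖ = cᵏ ‖V(t₀, x₀)‖ → ∞` (iterate `V(t, x) = c V(c²t, cx)` at the zoomed point). For a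
witness of the crux (representative `V` of A1/A2, nonzero somewhere by nontriviality) this says that no
modification on null sets makes the profile locally bounded at the space–time origin — `(0, 0)` is singular
in the CKN sense — while by Schur (stub D) `V(t, 0) = 0` on the whole time axis.
[sources: Leray1934 (3.11); CKN1982 (singular points); folklore] -/
theorem stub_singularOrigin :
    ∀ (c : ℝ) (V : ℝ → EuclideanSpace ℝ (Fin 3) → EuclideanSpace ℝ (Fin 3)), 1 < c →
      IsDiscretelySelfSimilar c V → (∃ t₀ < 0, ∃ x₀, V t₀ x₀ ≠ 0) →
      ∀ r : ℝ, 0 < r → ∀ M : ℝ, ∃ t ∈ Set.Ioo (-r ^ 2) 0, ∃ x : EuclideanSpace ℝ (Fin 3),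
        ‖x‖ < r ∧ M < ‖V t x‖ :=
  -- LANDED p159845 (lead c16, wave 1)
  _root_.Summit.NavierStokesRegularity.NavierStokesRegularity.Theorems.PolyhedralDssProfileExists.PolyhedralCell.stub_singularOrigin

/-- **Stub N4 (M; worker): every negative slice of a witness is nontrivial.** If an ancient mild solution
`u` (duality form, measurable slices), exactly `c`-DSS (`c > 1`) with a Type-I bound, has ONE negative slice
`u(t₁)` a.e. zero, then all its negative slices are a.e. zero. So the crux's `¬ ∀ t < 0, u t =ᵐ 0` upgrades
to `∀ t < 0, ¬ u t =ᵐ 0` for witnesses. Proof route: representative `V` (A1), DSS transported (A2 with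
`G = ⊥`); `V(t₁) = 0` (continuous slice, a.e. zero); FORWARD on `(t₁, 0)`: `V` and `0` both solve the Oseen
integral equation from the zero datum at `t₁` (`IsTypeIAncientMild.mild_eq`, `heatFlow` of `0` is `0`,
`oseenDuhamel_zero_left`) and are bounded on `(t₁, t₂)` for every `t₂ < 0`, so `V(t) = 0` there
(`oseenMild_bounded_unique` + continuity); BACKWARD for `t ≤ t₁`: `V(t, x) = c⁻ᵏ V(c⁻²ᵏt, c⁻ᵏx)` with
`c⁻²ᵏ t ∈ (t₁, 0)` for `k` large. Then `u t =ᵐ V t = 0`.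
[sources: KNSS2009 §4 (uniqueness of bounded mild solutions); tree `oseenMild_bounded_unique`; folklore] -/
theorem stub_sliceNonzero :
    ∀ (c : ℝ) (u : ℝ → EuclideanSpace ℝ (Fin 3) → EuclideanSpace ℝ (Fin 3)) (C₀ : ℝ), 1 < c →
      IsAncientMildSolution 1 u → (∀ t < 0, AEStronglyMeasurable (u t) volume) →
      IsDiscretelySelfSimilar c u → HasTypeIDecay C₀ u →
      (∃ t₁ < 0, u t₁ =ᵐ[volume] 0) → ∀ t < 0, u t =ᵐ[volume] 0 :=
  -- LANDED p159754 (lead c16, wave 1)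
  _root_.Summit.NavierStokesRegularity.NavierStokesRegularity.Theorems.PolyhedralDssProfileExists.PolyhedralCell.stub_sliceNonzero

/-- **Stub N5 (L; worker; new): no small slice — a universal scale-invariant lower bound on EVERY slice.**
There is an absolute `ε₁ > 0` such that: if `V` is an Oseen-gauge Type-I field (`IsTypeIAncientMild C V`),
exactly `c`-DSS (`c > 1`), with a Type-I space–time bound `HasTypeIDecay C₀ V` (so `V(t₁) ∈ L⁴`), and ONE
slice is small in the scale-invariant sup norm, `√(-t₁) ‖V(t₁, x)‖ ≤ ε₁` for all `x`, then `V ≡ 0` on the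
past. Proof route: Kato's bounded Picard scheme (`exists_oseen_fixedPoint_bounded` at `p = 4`, `ν = 1`,
datum `a = V(t₁)`, `A = ε₁/√(-t₁)`, `T = -t₁`; its smallness condition `C·A·2√T ≤ 1/8` reads `16 C ε₁ ≤ 1`,
INDEPENDENT of `t₁`) produces a solution `W` on `(0, -t₁)` bounded by `2A`, i.e. — shifted to `(t₁, 0)` with
`oseenDuhamel_comp_sub_right` — living up to the blow-up time; uniqueness of bounded Oseen-mild solutions
(`oseenMild_bounded_unique` on `(t₁, t₂)`, every `t₂ < 0`) and continuity give `‖V(t, x)‖ ≤ 2A` on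
`(t₁, 0) × ℝ³`; but the zoom images `V(c⁻²ᵏt₁, c⁻ᵏx) = cᵏ V(t₁, x)` lie in that slab, so `V(t₁) = 0`, and
then `V ≡ 0` (forward by uniqueness from the zero datum, backward along the zoom, as in N4). Consequence for
the crux: every slice of every witness has `√(-t)‖V(t)‖_∞ > ε₁` — a period-free, constant-free floor
(compare `stub_noSmallCell`, p153357, which needs smallness on a whole period).
[sources: LemarieRieusset2016 Thm 5.1 / Thm 9.12 (existence time `∼ ‖u(t₀)‖_∞⁻²`); KNSS2009 §4; Leray1934 (3.11); tree `exists_oseen_fixedPoint_bounded`, `oseenMild_bounded_unique`] -/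
theorem stub_noSmallSlice :
    ∃ ε₁ : ℝ, 0 < ε₁ ∧ ∀ (c C C₀ : ℝ) (V : ℝ → EuclideanSpace ℝ (Fin 3) → EuclideanSpace ℝ (Fin 3)),
      1 < c → IsTypeIAncientMild C V → IsDiscretelySelfSimilar c V → HasTypeIDecay C₀ V →
      ∀ t₁ < 0, (∀ x, Real.sqrt (-t₁) * ‖V t₁ x‖ ≤ ε₁) → ∀ t < 0, ∀ x, V t x = 0 :=
  -- LANDED p160315 (lead c16, wave 1)
  _root_.Summit.NavierStokesRegularity.NavierStokesRegularity.Theorems.PolyhedralDssProfileExists.PolyhedralCell.stub_noSmallSlice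

/-- **Stub N6 (M/L; worker; new): isotropy of radially weighted second moments (Schur on `Sym² ℝ³`).**
Let `G` be a subgroup of the linear isometries of `ℝ³` acting irreducibly (every `G`-invariant subspace is
`⊥` or `⊤`), `w : ℝ³ → ℝ³` continuous and `G`-equivariant (`w(g x) = g w(x)`), and `φ : ℝ → ℝ` a continuous
radial weight with `x ↦ φ(‖x‖) ‖w(x)‖²` integrable. Then for all `a, b ∈ ℝ³`,
`∫ φ(‖x‖) ⟪a, w x⟫⟪b, w x⟫ dx = (⟪a, b⟫/3) ∫ φ(‖x‖) ‖w x‖² dx`: the symmetric bilinear form on the left is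
`G`-invariant (change of variables `x ↦ g x`, volume-preserving, `‖g x‖ = ‖x‖`), so its self-adjoint
operator commutes with `G` and is a scalar (`schurJet_isSymmetric_eq_smul`, p156249), fixed by the trace.
For a witness of the crux (`w = V(t, ·)`, `φ` any continuous weight with `φ(|x|)|V|² ∈ L¹`, e.g.
`φ(r) = (1 + r)⁻²` or a Gaussian) this is the shell-by-shell ISOTROPY of the Reynolds-stress tensor of a
polyhedral profile: `∫ φ VᵢVⱼ = ⅓ δᵢⱼ ∫ φ|V|²` — a null test for any candidate and the reason no quadratic
anisotropy functional can detect the polyhedral sector.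
[sources: SerreLinearRepresentations1977 §13.2 (real Schur); route thesis (Schur); tree `schurJet_isSymmetric_eq_smul`] -/
theorem stub_isotropicMoments :
    ∀ (G : Subgroup (EuclideanSpace ℝ (Fin 3) ≃ₗᵢ[ℝ] EuclideanSpace ℝ (Fin 3))),
      (∀ V : Submodule ℝ (EuclideanSpace ℝ (Fin 3)), (∀ g ∈ G, ∀ v ∈ V, g v ∈ V) → V = ⊥ ∨ V = ⊤) →
      ∀ (w : EuclideanSpace ℝ (Fin 3) → EuclideanSpace ℝ (Fin 3)) (φ : ℝ → ℝ),
        Continuous w → Continuous φ → (∀ g ∈ G, ∀ x, w (g x) = g (w x)) →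
        Integrable (fun x => φ ‖x‖ * ‖w x‖ ^ 2) volume →
        ∀ a b : EuclideanSpace ℝ (Fin 3),
          ∫ x, φ ‖x‖ * (⟪a, w x⟫_ℝ * ⟪b, w x⟫_ℝ) = ⟪a, b⟫_ℝ / 3 * ∫ x, φ ‖x‖ * ‖w x‖ ^ 2 :=
  -- LANDED p159902 (lead c16, wave 1)
  _root_.Summit.NavierStokesRegularity.NavierStokesRegularity.Theorems.PolyhedralDssProfileExists.PolyhedralCell.stub_isotropicMoments

/-! ## Registered necessary-condition stubs of lead c16, wave 2 (N7–N10) -/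

/-- **Stub N7 (M/L; worker): no witness is axisymmetric (KNSS 2009 Thm 5.3 + the Seregin–Šverák
`C/r` bound, ON THE CRUX's class; symmetry-free in `G`).** An ancient mild solution `u` (duality form,
measurable slices) with a Type-I space–time bound `‖u(t,x)‖ ≤ C₀/(‖x‖ + √(-t))` whose negative slices are
axisymmetric about the `x₃`-axis in the a.e. sense (`u(t, R_θ x) = R_θ u(t, x)` for a.e. `x`, every `θ`,
every `t < 0`) has all its negative slices a.e. zero. Proof route: representative `V` (A1:
`IsTypeIAncientMild C V`, `HasTypeIDecay C₀ V`, `V t =ᵐ u t`); for `δ > 0` the shifted field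
`V_δ = V(· − δ)` is a BOUNDED ancient mild solution (`IsTypeIAncientMild.isBoundedAncientMildSolution_sub`),
hence a bounded weak solution on the past (`IsBoundedAncientMildSolution.isBoundedWeakNSSolutionOn`);
its slices are a.e. axisymmetric (transport of the hypothesis along `V t =ᵐ u t`, `rotZ θ` volume
preserving); `cylRadius x · ‖V_δ(t,x)‖ ≤ ‖x‖ · C₀/(‖x‖ + √(δ − t)) ≤ C₀`; the DISCHARGED fact
`KNSS2009_liouville_bound_C_over_r_holds` gives `V_δ(t) =ᵐ 0` for a.e. `t < 0`, continuity of `V`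
upgrades to every `t < −δ`, every `δ > 0`; so `V ≡ 0` on the past and `u t =ᵐ 0`. For the route: the
thesis' "axisymmetric sectors are forbidden (Seregin–Šverák 2009)" as a theorem about witnesses — any
witness of X⁻ is genuinely non-axisymmetric about every axis (this stub: the `x₃`-axis; conjugate by a
rotation for the others). [sources: KNSS2009 Thm 5.3 (arXiv:0709.3599 p. 10); SereginSverak2009 Thm 1.1; tree `KNSS2009_liouville_bound_C_over_r_holds` (KNSSThm53OfWindow.lean:624), `IsBoundedAncientMildSolution.isBoundedWeakNSSolutionOn` (AncientMildWeak.lean:688)] -/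
theorem stub_notAxisymmetric :
    ∀ (u : ℝ → EuclideanSpace ℝ (Fin 3) → EuclideanSpace ℝ (Fin 3)) (C₀ : ℝ),
      IsAncientMildSolution 1 u → (∀ t < 0, AEStronglyMeasurable (u t) volume) → HasTypeIDecay C₀ u →
      (∀ θ : ℝ, ∀ t < 0, (fun x => u t (rotZ θ x)) =ᵐ[volume] fun x => rotZ θ (u t x)) →
      ∀ t < 0, u t =ᵐ[volume] 0 :=
  -- LANDED p160737 (lead c16, wave 2)
  _root_.Summit.NavierStokesRegularity.NavierStokesRegularity.Theorems.PolyhedralDssProfileExists.PolyhedralCell.stub_notAxisymmetric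

/-- **Stub N8 (M/L; worker): the second-order Schur jet at the singular point.** Let `G` act
irreducibly on `ℝ³` and let `(V, p)` be a classical Navier–Stokes solution on the open past (`ν = 1`, zero
force) with `V(t, ·)` `G`-equivariant for every `t`. Then for every `t < 0`: `V(t,0) = 0` and
`DV(t,0) = 0` (stub D, `stub_schurJet`, with `div V(t) = 0`), and moreover `ΔV(t, 0) = 0`,
`∇p(t, 0) = 0` and `D²p(t, 0) = 0`. Proof route: the momentum equation at `x = 0` reads
`∂ₜV(t,0) + DV(t,0)[V(t,0)] + ∇p(t,0) = ΔV(t,0)` with `∂ₜV(t,0) = 0` (time derivative of the zero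
function `s ↦ V(s,0)`) and the convective term zero, so `∇p(t,0) = ΔV(t,0)`; `ΔV(t,·)` is `G`-equivariant
(the Laplacian commutes with linear isometries) hence `G`-fixed at `0`, hence zero
(`schurJet_fixedVector_eq_zero`); `∇p(t,·) = ΔV − ∂ₜV − (V·∇)V` is `G`-equivariant, so its derivative
at `0`, the pressure Hessian, commutes with `G` and is symmetric, hence a scalar `μ·𝟙`
(`schurJet_isSymmetric_eq_smul`), and its trace `Δp(t,0) = −tr((DV(t,0))²) = 0` (pressure Poisson
equation, `laplacian_pressure_eq_of_isClassicalNSSolutionOn`) forces `μ = 0`. For a witness of the crux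
(representative `V` of A1/A2 with its classical pressure, p152134): the singular point is a harmonic
stagnation point of every velocity slice and a second-order-flat critical point of every pressure slice.
[sources: route thesis (Schur); SerreLinearRepresentations1977 §13.2; Tao2011 (8) (pressure Poisson); tree `stub_schurJet` (p156249), `laplacian_pressure_eq_of_isClassicalNSSolutionOn`] -/
theorem stub_centreJet2 :
    ∀ (G : Subgroup (EuclideanSpace ℝ (Fin 3) ≃ₗᵢ[ℝ] EuclideanSpace ℝ (Fin 3))),
      (∀ W : Submodule ℝ (EuclideanSpace ℝ (Fin 3)), (∀ g ∈ G, ∀ v ∈ W, g v ∈ W) → W = ⊥ ∨ W = ⊤) →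
      ∀ (V : ℝ → EuclideanSpace ℝ (Fin 3) → EuclideanSpace ℝ (Fin 3)) (p : ℝ → EuclideanSpace ℝ (Fin 3) → ℝ),
        IsClassicalNSSolutionOn (Set.Iio 0) 1 0 V p → (∀ g ∈ G, ∀ t x, V t (g x) = g (V t x)) →
        ∀ t < 0, V t 0 = 0 ∧ fderiv ℝ (V t) 0 = 0 ∧ (Δ (V t)) 0 = 0 ∧
          gradient (p t) 0 = 0 ∧ fderiv ℝ (gradient (p t)) 0 = 0 :=
  -- LANDED p160606 (lead c16, wave 2)
  _root_.Summit.NavierStokesRegularity.NavierStokesRegularity.Theorems.PolyhedralDssProfileExists.PolyhedralCell.stub_centreJet2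

/-- **Stub N9 (M; worker): every slice of a witness carries vorticity.** If `V` is an Oseen-gauge
Type-I field (`IsTypeIAncientMild C V`), exactly `c`-DSS (`c > 1`), with a Type-I space–time bound
`HasTypeIDecay C₀ V`, and nonzero somewhere on the past, then NO negative slice is irrotational:
`curl V(t, ·) ≢ 0` for every `t < 0`. Proof route: if `curl V(t₁) ≡ 0`, the slice is smooth, divergence
free (`IsTypeIAncientMild.isDivFree`) and bounded, hence constant
(`eq_of_curl_eq_zero_of_isDivFree_of_bounded`, CurlFreeLiouville.lean), and the Type-I bound
`‖V(t₁,x)‖ ≤ C₀/(‖x‖ + √(-t₁)) → 0` makes the constant `0`; then `V ≡ 0` on the past by the landed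
helpers of N4 (`sliceNonzero_forward`: forward by uniqueness of bounded Oseen-mild solutions;
`sliceNonzero_backward`: backward along the zoom), contradicting nontriviality.
[sources: KNSS2009 Lemma 3.1 / proof of Thm 5.2 (curl-free div-free bounded ⇒ constant); tree CurlFreeLiouville.lean, …StubSliceNonzero.lean (p159754)] -/
theorem stub_vorticityEverySlice :
    ∀ (c C C₀ : ℝ) (V : ℝ → EuclideanSpace ℝ (Fin 3) → EuclideanSpace ℝ (Fin 3)), 1 < c →
      IsTypeIAncientMild C V → IsDiscretelySelfSimilar c V → HasTypeIDecay C₀ V →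
      (∃ t₀ < 0, ∃ x₀, V t₀ x₀ ≠ 0) → ∀ t < 0, ∃ x, curl (V t) x ≠ 0 :=
  -- LANDED p160558 (lead c16, wave 2)
  _root_.Summit.NavierStokesRegularity.NavierStokesRegularity.Theorems.PolyhedralDssProfileExists.PolyhedralCell.stub_vorticityEverySlice

/-- **Stub N10 (L/XL; worker; new): the Gaussian enstrophy identity of a periodic Leray orbit.** Let
`(U, P)` be a classical solution of the backward Leray system `∂ₛU + ½U + ½(y·∇)U + (U·∇)U + ∇P = ΔU`,
`div U = 0` on `ℝ × ℝ³`, `S`-periodic in `s` (`S > 0`), with polynomial bounds on `U`, `DU`, `∂ₛU`, `P`,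
`∇P`. Then, with the Gaussian `w₀(y) = e^{−|y|²/4}` and the head pressure `Π̃ = P + ½|U|² + ½ y·U`
(`headPressure ½ U P`),
`∫₀^S ∫ w₀ |curl U|² dy ds = −½ ∫₀^S ∫ w₀ Π̃ (y·U) dy ds`.
Proof route: the pointwise Bernoulli identity of the tree (`PineauVicol2026.bernoulli_identity_rdss`
with `α = 0`, `Us = ∂ₛU(s,·)`; its pressure-Poisson hypothesis from
`laplacian_pressure_eq_of_isClassicalNSSolutionOn`, the Leray drift force being divergence free):
`driftOp 1 ½ U Π̃ = |curl U|² + ⟪U + ½y, ∂ₛU⟫`, `driftOp 1 ½ U f = Δf − Df[U + ½y]`; integrate against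
`w₀` with the cut-off integration by parts `integral_cutoff_mul_weight_mul_drift`
(PineauVicolWeightedIdentity.lean) and `R → ∞` (Gaussian tails, polynomial bounds):
`∫ w₀ driftOp(Π̃) = ∫ Π̃ (Δw₀ + div(w₀ (U + ½y))) = −½ ∫ Π̃ (y·U) w₀` since
`Δw₀ = (|y|²/4 − 3/2) w₀`, `div(w₀(U + ½y)) = (3/2 − |y|²/4 − ½ y·U) w₀`; finally
`∫₀^S ∫ w₀ ⟪U + ½y, ∂ₛU⟫ = ∫ w₀ [½|U|² + ½ y·U]₀^S = 0` by periodicity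
(`intervalIntegral_integral_weight_mul_inner_deriv_eq_zero`). Meaning: over a period the Gaussian
enstrophy of the orbit equals `−½ ×` the Gaussian correlation of head pressure with radial velocity — a
nontrivial orbit PUMPS high-head fluid inward on (weighted) average; `y·U ≡ 0` (tangential orbits) forces
`curl U ≡ 0`. This is the Gaussian-weight form of Pineau–Vicol's (5.4)/(7.10) (their adjoint weight
replaced by `w₀`, which is not in `ker L*`: `L*w₀ = ½ (y·U) w₀` is exactly the right-hand side) and the
only surviving form of Tsai's head-pressure argument for `s`-dependent profiles; every witness's Leray
orbit (stub C) is subject to it once its derivative/pressure bounds are supplied.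
[sources: PineauVicol2026 (4.3), (5.4), (7.7)–(7.10) (arXiv:2607.09619v2 pp. 11–13, 25–26); Tsai1998 (1.7); tree PineauVicolBernoulli.lean, PineauVicolWeightedIdentity.lean, PressurePoisson.lean] -/
theorem stub_gaussianEnstrophyIdentity :
    ∀ (U : ℝ → EuclideanSpace ℝ (Fin 3) → EuclideanSpace ℝ (Fin 3)) (P : ℝ → EuclideanSpace ℝ (Fin 3) → ℝ)
      (S : ℝ), 0 < S → IsBackwardLeraySolutionOn Set.univ 1 U P → Function.Periodic U S →
      (∃ K : ℝ, ∃ N : ℕ, ∀ s y,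
          ‖U s y‖ ≤ K * (1 + ‖y‖) ^ N ∧ ‖fderiv ℝ (U s) y‖ ≤ K * (1 + ‖y‖) ^ N ∧
          ‖timeDeriv U s y‖ ≤ K * (1 + ‖y‖) ^ N ∧ |P s y| ≤ K * (1 + ‖y‖) ^ N ∧
          ‖gradient (P s) y‖ ≤ K * (1 + ‖y‖) ^ N) →
      ∫ s in (0 : ℝ)..S, ∫ y, Real.exp (-‖y‖ ^ 2 / 4) * ‖curl (U s) y‖ ^ 2 =
        -(1 / 2 : ℝ) * ∫ s in (0 : ℝ)..S, ∫ y, Real.exp (-‖y‖ ^ 2 / 4) *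
          ((P s y + ‖U s y‖ ^ 2 / 2 + ⟪y, U s y⟫_ℝ / 2) * ⟪y, U s y⟫_ℝ) :=
  -- LANDED p162020 (lead c16, wave 2; helpers p161569)
  _root_.Summit.NavierStokesRegularity.NavierStokesRegularity.Theorems.PolyhedralDssProfileExists.PolyhedralCell.stub_gaussianEnstrophyIdentity

/-- **Sub-stub N10a (registered by the N10 worker for its helpers file; LANDED p161569): the slice Bernoulli identity of
the backward Leray system** — `|curl U|² = driftOp(Π̃) − ⟪U + ½y, ∂ₛU⟫` pointwise, `Π̃ = headPressure ½ U P`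
(Pineau–Vicol 2026 (7.7) with `α = 0`; Tsai 1998 (1.7) with the time term). -/
theorem stub_gaussianEnstrophySliceBernoulli :
    ∀ (U : ℝ → EuclideanSpace ℝ (Fin 3) → EuclideanSpace ℝ (Fin 3)) (P : ℝ → EuclideanSpace ℝ (Fin 3) → ℝ),
      IsBackwardLeraySolutionOn Set.univ 1 U P → ∀ (s : ℝ) (y : EuclideanSpace ℝ (Fin 3)),
      ‖curl (U s) y‖ ^ 2 =
        ((Δ (headPressure (1 / 2) (U s) (P s))) y -
            fderiv ℝ (headPressure (1 / 2) (U s) (P s)) y (U s y + (1 / 2 : ℝ) • y)) -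
          ⟪U s y + (1 / 2 : ℝ) • y, timeDeriv U s y⟫_ℝ :=
  -- LANDED p161569
  _root_.Summit.NavierStokesRegularity.NavierStokesRegularity.Theorems.PolyhedralDssProfileExists.PolyhedralCell.stub_gaussianEnstrophySliceBernoulli

/-- **Stub N14 (M/L; worker): inward pumping of head pressure (strict sign in the Gaussian identity).** Under the
hypotheses of N10 plus the profile bound `(1+|y|)|U| ≤ C₀` and nontriviality of the orbit, the period-averaged
Gaussian correlation of the head pressure `Π̃ = P + ½|U|² + ½ y·U` with the radial velocity `y·U` is STRICTLY
NEGATIVE: `∫₀^S ∫ w₀ Π̃ (y·U) < 0`. Proof route: by N10 it equals `−2 ∫₀^S∫ w₀|curl U|²`, which is `≤ 0`; if it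
vanished, the continuous nonnegative integrand would vanish on `[0,S] × ℝ³` (`w₀ > 0`), so every slice `U(s)`,
`s ∈ [0,S]`, would be curl-free, divergence-free and bounded, hence constant (`eq_of_curl_eq_zero_of_isDivFree_of_bounded`),
hence zero by the profile decay, and by periodicity `U ≡ 0` — contradicting nontriviality. Consequences: no witness orbit
is tangential (`y·U ≢ 0`), and on Gaussian average a witness transports high-head fluid INWARD (`y·U < 0` where `Π̃` is
large). [sources: PineauVicol2026 (5.4); Tsai1998 (1.7); tree N10 (p162020), CurlFreeLiouville.lean] -/
theorem stub_headPressurePumping :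
    ∀ (U : ℝ → EuclideanSpace ℝ (Fin 3) → EuclideanSpace ℝ (Fin 3)) (P : ℝ → EuclideanSpace ℝ (Fin 3) → ℝ)
      (S C₀ : ℝ), 0 < S → IsBackwardLeraySolutionOn Set.univ 1 U P → Function.Periodic U S →
      (∃ K : ℝ, ∃ N : ℕ, ∀ s y,
          ‖U s y‖ ≤ K * (1 + ‖y‖) ^ N ∧ ‖fderiv ℝ (U s) y‖ ≤ K * (1 + ‖y‖) ^ N ∧
          ‖timeDeriv U s y‖ ≤ K * (1 + ‖y‖) ^ N ∧ |P s y| ≤ K * (1 + ‖y‖) ^ N ∧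
          ‖gradient (P s) y‖ ≤ K * (1 + ‖y‖) ^ N) →
      (∀ s y, (1 + ‖y‖) * ‖U s y‖ ≤ C₀) → (∃ s y, U s y ≠ 0) →
      ∫ s in (0 : ℝ)..S, ∫ y, Real.exp (-‖y‖ ^ 2 / 4) *
          ((P s y + ‖U s y‖ ^ 2 / 2 + ⟪y, U s y⟫_ℝ / 2) * ⟪y, U s y⟫_ℝ) < 0 :=
  -- LANDED p162892 (lead c16, wave 3)
  _root_.Summit.NavierStokesRegularity.NavierStokesRegularity.Theorems.PolyhedralDssProfileExists.PolyhedralCell.stub_headPressurePumping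

/-! ## Registered necessary-condition stubs of lead c16, wave 3 (N12–N13) -/

/-- **Stub N12 (L; worker): uniform bounds for the Leray orbit of a Type-I classical solution (the
bridge from witnesses to N10).** For every `C₀` there is `K = K(C₀) ≥ 0` such that for every classical
solution `(u, p)` of Navier–Stokes (`ν = 1`, zero force) on the open past with the Type-I bound
`HasTypeIDecay C₀ u`, the Leray orbit `U = lerayOrbit u` (`U(s,y) = e^{−s/2} u(−e^{−s}, e^{−s/2}y)`) solves
the backward Leray system on `ℝ × ℝ³` with a pressure `P` normalised by `P(s, 0) = 0`, and, uniformly in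
`s`: `(1+|y|)|U| ≤ C₀`, `‖DU‖ ≤ K/max{|y|,1}²`, `‖D²U‖ ≤ K/max{|y|,1}³`, `‖∇P‖ ≤ K(1+|y|)³`,
`|P| ≤ K(1+|y|)⁴`, `‖∂ₛU‖ ≤ K(1+|y|)³`. Proof route (all in the Pineau–Vicol discharge files): the
orbit solves the system with `lerayOrbitPressure p` (`isClassicalNSSolutionOn_iff_isBackwardLeraySolutionOn_lerayOrbit`);
profile bound `hasTypeIDecay_iff_lerayOrbit`; derivative bounds `PineauVicol2026.exists_forall_iteratedFDeriv_lerayOrbit_le`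
(n = 1, 2; Lemma 7.1 (7.2)); `∇p(t) = ∇Q[u(t)]` (`PineauVicol2026.gradient_pressure_eq_of_typeI`, after rescaling
the window) with `‖∇Q[v]‖ ≤ K(B + C²(2+|x|)³)` on the decay class (`exists_bound_fderiv_pressurePotential`,
dilation covariance `pressurePotential_smul_comp_smul`); normalise `P(s,y) = lerayOrbitPressure p s y − lerayOrbitPressure p s 0`
(a pressure shift by a function of `s` keeps the classical system); `|P| ≤ |y| sup ‖∇P‖`; `∂ₛU` from
`norm_timeDerivWithin_le_of_leray`. [sources: PineauVicol2026 Lemma 2.1, Lemma 7.1 (7.1)–(7.3) (arXiv:2607.09619 pp. 9–10, 23–24); Tao2011 Lemma 4.1; tree files PineauVicolLerayBounds, PineauVicolLerayPressure, PineauVicolPressureIdentification] -/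
theorem stub_orbitBounds :
    ∀ C₀ : ℝ, ∃ K : ℝ, 0 ≤ K ∧
      ∀ (u : ℝ → EuclideanSpace ℝ (Fin 3) → EuclideanSpace ℝ (Fin 3)) (p : ℝ → EuclideanSpace ℝ (Fin 3) → ℝ),
        IsClassicalNSSolutionOn (Set.Iio 0) 1 0 u p → HasTypeIDecay C₀ u →
        ∃ P : ℝ → EuclideanSpace ℝ (Fin 3) → ℝ,
          IsBackwardLeraySolutionOn Set.univ 1 (lerayOrbit u) P ∧ (∀ s, P s 0 = 0) ∧
          ∀ s y, (1 + ‖y‖) * ‖lerayOrbit u s y‖ ≤ C₀ ∧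
            ‖fderiv ℝ (lerayOrbit u s) y‖ ≤ K * ((max ‖y‖ 1)⁻¹) ^ 2 ∧
            ‖iteratedFDeriv ℝ 2 (lerayOrbit u s) y‖ ≤ K * ((max ‖y‖ 1)⁻¹) ^ 3 ∧
            ‖gradient (P s) y‖ ≤ K * (1 + ‖y‖) ^ 3 ∧ |P s y| ≤ K * (1 + ‖y‖) ^ 4 ∧
            ‖timeDeriv (lerayOrbit u) s y‖ ≤ K * (1 + ‖y‖) ^ 3 :=
  -- LANDED p162679 (lead c16, wave 3)
  _root_.Summit.NavierStokesRegularity.NavierStokesRegularity.Theorems.PolyhedralDssProfileExists.PolyhedralCell.stub_orbitBounds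

/-- **Stub N13 (L/XL; worker): the local-enstrophy floor (Pineau–Vicol 2026, Prop. 3.1 / §7.5
absorption, α = 0, ON THE CRUX's class).** There is an absolute `δ₀ > 0` and, for every `C₀`, a radius
`R = R(C₀) > 0` such that: a classical solution `(u, p)` on the open past with `HasTypeIDecay C₀ u`, exactly
`c`-DSS (`c > 1`), whose Leray orbit has local enstrophy `‖curl U(s)‖_{L²(B_R)} ≤ δ₀` for EVERY `s` in one
period `[0, 2 log c]`, is identically zero on the past. Hence every witness's orbit has, in every period, a
slice with `‖Ω(s)‖_{L²(B_{R(C₀)})} > δ₀` — the quantitative enstrophy floor the route's kill switch #3 would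
need everywhere. Proof route: `U = lerayOrbit u`, `P = lerayOrbitPressure p` solve the backward Leray system
on `ℝ × ℝ³`, `U` is `2 log c`-periodic (`IsDiscretelySelfSimilar.periodic_lerayOrbit`), `|U| ≤ C₀`, slices in
`L⁴`, all derivative/integrability side conditions from Lemma 7.1 (7.2)
(`PineauVicol2026.exists_forall_iteratedFDeriv_lerayOrbit_le`, every `n`: `‖DⁿU‖ ≤ Kₙ/max{|y|,1}^{n+1}`),
`‖DU‖ ≤ ⅛` for `|y| ≥ R := max 1 √(8K₁)`, the time term over a period vanishes
(`PineauVicol2026.intervalIntegral_integral_inner_timeDeriv_vorticity_eq_zero` with `θ = 0`), so the tree's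
absorption theorem `PineauVicol2026.curl_eq_zero_of_small_local_enstrophy` (with `vortexConst · δ₀ < ⅛`)
gives `curl U ≡ 0` on the period; each slice is then curl- and divergence-free and bounded, hence constant
(`eq_of_curl_eq_zero_of_isDivFree_of_bounded`), hence zero by the profile decay; periodicity spreads
`U ≡ 0` to all `s`, i.e. `u ≡ 0` on the past. [sources: PineauVicol2026 Prop. 3.1, §7.5, (7.12) (arXiv:2607.09619 pp. 10, 26–27); tree PineauVicolEnstrophy.lean:953, PineauVicolEnstrophyTime.lean, PineauVicolLerayBounds.lean, CurlFreeLiouville.lean] -/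
theorem stub_enstrophyFloor :
    ∃ δ₀ : ℝ, 0 < δ₀ ∧ ∀ C₀ : ℝ, ∃ R : ℝ, 0 < R ∧
      ∀ (c : ℝ) (u : ℝ → EuclideanSpace ℝ (Fin 3) → EuclideanSpace ℝ (Fin 3))
        (p : ℝ → EuclideanSpace ℝ (Fin 3) → ℝ), 1 < c →
        IsClassicalNSSolutionOn (Set.Iio 0) 1 0 u p → HasTypeIDecay C₀ u → IsDiscretelySelfSimilar c u →
        (∀ s ∈ Set.Icc (0 : ℝ) (2 * Real.log c),
          Real.sqrt (∫ y in Metric.ball (0 : EuclideanSpace ℝ (Fin 3)) R, ‖curl (lerayOrbit u s) y‖ ^ 2) ≤ δ₀) →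
        ∀ t < 0, ∀ x, u t x = 0 :=
  -- LANDED p162579 (lead c16, wave 3)
  _root_.Summit.NavierStokesRegularity.NavierStokesRegularity.Theorems.PolyhedralDssProfileExists.PolyhedralCell.stub_enstrophyFloor

/-! ## Registered assembly stub of lead c16 (N11; proved by the lead): the portrait of a witness -/

/-- **Stub N11 (M; lead): the portrait of a witness of the crux.** There is an absolute `ε₁ > 0` such
that every witness `(G, c, u, C₀)` of `QuantisedSymmetry.PolyhedralDssProfileExists` (finite `G` and
`det = 1` are not needed) admits an Oseen-gauge representative `V` (`IsTypeIAncientMild C V`, same Type-I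
constant, `V t =ᵐ u t`), exactly `c`-DSS and `G`-equivariant, classical on the open past for some pressure
`p`, with: `u` is NOT continuously self-similar (N1); every slice of `V` exceeds the scale-invariant floor
`ε₁` somewhere (N5) and carries vorticity (N9); the 2-jet at the singular point vanishes —
`V(t,0) = 0`, `DV(t,0) = 0`, `ΔV(t,0) = 0`, `∇p(t,0) = 0`, `D²p(t,0) = 0` (D, N8); `V` is unbounded in
every parabolic cylinder at the origin (N3); and `V` is not axisymmetric about the `x₃`-axis (N7).
Assembly of the landed stubs A1 (p156260), A2 (p155960), p152134, N1 (p159657), N3 (p159845), N5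
(p160315), N7 (p160737), N8 (p160606), N9 (p160558). [sources: the cited stubs; folklore] -/
theorem stub_witnessPortrait :
    ∃ ε₁ : ℝ, 0 < ε₁ ∧
      ∀ (G : Subgroup (EuclideanSpace ℝ (Fin 3) ≃ₗᵢ[ℝ] EuclideanSpace ℝ (Fin 3))) (c : ℝ)
        (u : ℝ → EuclideanSpace ℝ (Fin 3) → EuclideanSpace ℝ (Fin 3)) (C₀ : ℝ),
        (∀ W : Submodule ℝ (EuclideanSpace ℝ (Fin 3)), (∀ g ∈ G, ∀ v ∈ W, g v ∈ W) → W = ⊥ ∨ W = ⊤) →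
        1 < c → IsAncientMildSolution 1 u → (∀ t < 0, AEStronglyMeasurable (u t) volume) →
        IsDiscretelySelfSimilar c u → HasTypeIDecay C₀ u → (∀ g ∈ G, ∀ t x, u t (g x) = g (u t x)) →
        ¬ (∀ t < 0, u t =ᵐ[volume] 0) →
        ∃ (V : ℝ → EuclideanSpace ℝ (Fin 3) → EuclideanSpace ℝ (Fin 3)) (C : ℝ)
          (p : ℝ → EuclideanSpace ℝ (Fin 3) → ℝ),
          IsTypeIAncientMild C V ∧ HasTypeIDecay C₀ V ∧ (∀ t < 0, V t =ᵐ[volume] u t) ∧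
          IsDiscretelySelfSimilar c V ∧ (∀ g ∈ G, ∀ t x, V t (g x) = g (V t x)) ∧
          IsClassicalNSSolutionOn (Set.Iio 0) 1 0 V p ∧
          ¬ IsSelfSimilar u ∧
          (∀ t < 0, ∃ x, ε₁ < Real.sqrt (-t) * ‖V t x‖) ∧
          (∀ t < 0, ∃ x, curl (V t) x ≠ 0) ∧
          (∀ t < 0, V t 0 = 0 ∧ fderiv ℝ (V t) 0 = 0 ∧ (Δ (V t)) 0 = 0 ∧
            gradient (p t) 0 = 0 ∧ fderiv ℝ (gradient (p t)) 0 = 0) ∧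
          (∀ r : ℝ, 0 < r → ∀ M : ℝ, ∃ t ∈ Set.Ioo (-r ^ 2) 0, ∃ x : EuclideanSpace ℝ (Fin 3),
            ‖x‖ < r ∧ M < ‖V t x‖) ∧
          ¬ (∀ t < 0, IsAxisymmetric (V t)) :=
  -- LANDED p161392 (lead c16)
  _root_.Summit.NavierStokesRegularity.NavierStokesRegularity.Theorems.PolyhedralDssProfileExists.PolyhedralCell.stub_witnessPortrait

/-! ## Registered assembly stub of lead c16 (N15; proved by the lead): the portrait of a witness, II (its orbit) -/

/-- **Stub N15 (M; lead): the portrait of a witness, II — its Leray orbit.** There are absolute constants `δ₀ > 0` and,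
for every `C₀`, a radius `R = R(C₀) > 0`, such that every witness `(G, c, u, C₀)` of the crux (irreducible `G`) has an
Oseen-gauge representative `V` (as in N11) with classical pressure, whose slices have ISOTROPIC Gaussian-weighted Reynolds
stresses (N6), and whose Leray orbit `U = lerayOrbit V` with a normalised pressure `P` (`P(s,0) = 0`, N12) is a
`2 log c`-periodic classical solution of the backward Leray system with the profile bound `(1+|y|)|U| ≤ C₀`, satisfies the
Gaussian enstrophy identity (N10) with STRICTLY negative head-pressure/radial-velocity correlation (N14), and has, in every
period, a slice with local enstrophy above the floor, `‖curl U(s)‖_{L²(B_R)} > δ₀` (N13). Assembly of N6, N10, N12, N13, N14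
over the representative pipeline A1/A2/p152134. [sources: the cited stubs; folklore] -/
theorem stub_witnessPortraitII :
    ∃ δ₀ : ℝ, 0 < δ₀ ∧ ∀ C₀ : ℝ, ∃ R : ℝ, 0 < R ∧
      ∀ (G : Subgroup (EuclideanSpace ℝ (Fin 3) ≃ₗᵢ[ℝ] EuclideanSpace ℝ (Fin 3))) (c : ℝ)
        (u : ℝ → EuclideanSpace ℝ (Fin 3) → EuclideanSpace ℝ (Fin 3)),
        (∀ W : Submodule ℝ (EuclideanSpace ℝ (Fin 3)), (∀ g ∈ G, ∀ v ∈ W, g v ∈ W) → W = ⊥ ∨ W = ⊤) →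
        1 < c → IsAncientMildSolution 1 u → (∀ t < 0, AEStronglyMeasurable (u t) volume) →
        IsDiscretelySelfSimilar c u → HasTypeIDecay C₀ u → (∀ g ∈ G, ∀ t x, u t (g x) = g (u t x)) →
        ¬ (∀ t < 0, u t =ᵐ[volume] 0) →
        ∃ (V : ℝ → EuclideanSpace ℝ (Fin 3) → EuclideanSpace ℝ (Fin 3)) (C : ℝ)
          (p : ℝ → EuclideanSpace ℝ (Fin 3) → ℝ) (P : ℝ → EuclideanSpace ℝ (Fin 3) → ℝ),
          IsTypeIAncientMild C V ∧ HasTypeIDecay C₀ V ∧ (∀ t < 0, V t =ᵐ[volume] u t) ∧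
          IsDiscretelySelfSimilar c V ∧ (∀ g ∈ G, ∀ t x, V t (g x) = g (V t x)) ∧
          IsClassicalNSSolutionOn (Set.Iio 0) 1 0 V p ∧
          (∀ t < 0, ∀ a b : EuclideanSpace ℝ (Fin 3),
            ∫ x, Real.exp (-‖x‖ ^ 2) * (⟪a, V t x⟫_ℝ * ⟪b, V t x⟫_ℝ) =
              ⟪a, b⟫_ℝ / 3 * ∫ x, Real.exp (-‖x‖ ^ 2) * ‖V t x‖ ^ 2) ∧
          IsBackwardLeraySolutionOn Set.univ 1 (lerayOrbit V) P ∧ (∀ s, P s 0 = 0) ∧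
          Function.Periodic (lerayOrbit V) (2 * Real.log c) ∧
          (∀ s y, (1 + ‖y‖) * ‖lerayOrbit V s y‖ ≤ C₀) ∧
          (∫ s in (0 : ℝ)..(2 * Real.log c), ∫ y, Real.exp (-‖y‖ ^ 2 / 4) * ‖curl (lerayOrbit V s) y‖ ^ 2 =
            -(1 / 2 : ℝ) * ∫ s in (0 : ℝ)..(2 * Real.log c), ∫ y, Real.exp (-‖y‖ ^ 2 / 4) *
              ((P s y + ‖lerayOrbit V s y‖ ^ 2 / 2 + ⟪y, lerayOrbit V s y⟫_ℝ / 2) * ⟪y, lerayOrbit V s y⟫_ℝ)) ∧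
          (∫ s in (0 : ℝ)..(2 * Real.log c), ∫ y, Real.exp (-‖y‖ ^ 2 / 4) *
              ((P s y + ‖lerayOrbit V s y‖ ^ 2 / 2 + ⟪y, lerayOrbit V s y⟫_ℝ / 2) * ⟪y, lerayOrbit V s y⟫_ℝ) < 0) ∧
          (∃ s ∈ Set.Icc (0 : ℝ) (2 * Real.log c),
            δ₀ < Real.sqrt (∫ y in Metric.ball (0 : EuclideanSpace ℝ (Fin 3)) R, ‖curl (lerayOrbit V s) y‖ ^ 2)) :=
  -- LANDED p163727 (lead c16)
  _root_.Summit.NavierStokesRegularity.NavierStokesRegularity.Theorems.PolyhedralDssProfileExists.PolyhedralCell.stub_witnessPortraitII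

/-! ## Registered necessary-condition stub of lead c16, wave 4 (N16) -/

/-- **Stub N16 (M/L; worker): all Gaussian-weighted FIRST moments of a polyhedral solenoidal field vanish (Schur on
`ℝ³ ⊗ ℝ³`).** Let `G` act irreducibly on `ℝ³` and let `w : ℝ³ → ℝ³` be `C¹`, bounded, divergence free and `G`-equivariant.
Then for all `a, b`: `∫ e^{−‖x‖²} ⟪a, x⟫⟪b, w x⟫ dx = 0` — in particular the weighted angular momentum `∫ e^{−‖x‖²} x × w`
and all weighted position–velocity correlations vanish. Proof route: the operator `T` with `⟪a, T b⟫ = ∫ e^{−‖x‖²}⟪a,x⟫⟪b,w x⟫`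
commutes with `G` (change of variables `x ↦ g x`, as in N6's `isoMoments_integral_map`), and its trace
`∑ᵢ ⟪eᵢ, T eᵢ⟫ = ∫ e^{−‖x‖²} ⟪x, w x⟫ dx = −½ ∫ ⟪∇e^{−‖x‖²}, w⟫ = ½ ∫ e^{−‖x‖²} div w = 0` (whole-space integration by
parts against the Gaussian; tree WholeSpaceIBP.lean / the cut-off lemma `integral_cutoff_mul_weight_mul_drift` pattern of N10);
a trace-free intertwiner of an irreducible `G` on `ℝ³` vanishes (`schurJet_eq_zero_of_comm_of_trace_eq_zero`, p156249), so
`T = 0`. For a witness (slices `V(t,·)` of the representative: smooth, bounded, div-free, equivariant) every such moment is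
zero at every time. [sources: SerreLinearRepresentations1977 §13.2; route thesis (Schur); tree StubSchurJet, StubIsotropicMoments] -/
theorem stub_firstMomentsVanish :
    ∀ (G : Subgroup (EuclideanSpace ℝ (Fin 3) ≃ₗᵢ[ℝ] EuclideanSpace ℝ (Fin 3))),
      (∀ W : Submodule ℝ (EuclideanSpace ℝ (Fin 3)), (∀ g ∈ G, ∀ v ∈ W, g v ∈ W) → W = ⊥ ∨ W = ⊤) →
      ∀ (w : EuclideanSpace ℝ (Fin 3) → EuclideanSpace ℝ (Fin 3)), ContDiff ℝ 1 w → VectorCalculus.IsDivFree w →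
        (∀ g ∈ G, ∀ x, w (g x) = g (w x)) → (∃ M : ℝ, ∀ x, ‖w x‖ ≤ M) →
        ∀ a b : EuclideanSpace ℝ (Fin 3), ∫ x, Real.exp (-‖x‖ ^ 2) * (⟪a, x⟫_ℝ * ⟪b, w x⟫_ℝ) = 0 :=
  -- LANDED p164773 (lead c16, wave 4)
  _root_.Summit.NavierStokesRegularity.NavierStokesRegularity.Theorems.PolyhedralDssProfileExists.PolyhedralCell.stub_firstMomentsVanish

/-! ## Registered necessary-condition stubs of lead c17, wave 1 (N17–N22): the SCAR theorems, axis alignment,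
the ancient Duhamel form, the Gaussian div–curl identity

None is a hypothesis of the composition; each lands `--supports stmt-NavierStokesRegularity-1404`. N17 and N19 are
stated for GENERAL Type-I ancient solutions (no symmetry, no self-similarity): they are new Liouville-type facts of
the tree in their own right. -/

/-- **Stub N17 — LANDED p167789 (M/L; worker): no slice of a nontrivial Type-I ancient mild solution is null at large scales
(Albritton–Barker's class `𝔹`).** Let `u` be an ancient mild solution (`ν = 1`, duality form) with measurable
slices and the Type-I bound `‖u(t,x)‖ ≤ C₀/(‖x‖ + √(−t))`. If at some `t₀ < 0` the Navier–Stokes zooms of the slice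
tend to zero in `𝒟′` — `∫ ⟪λ u(t₀, λx), φ(x)⟫ dx → 0` as `λ → ∞` for every smooth compactly supported `φ` — then
`u(t) = 0` a.e. for every `t ≤ t₀`. Proof route: Oseen-gauge representative `V` (A1, `stub_smoothRepresentative_ae`,
p156260: `IsTypeIAncientMild C V`, `HasTypeIDecay C₀ V`, `V t =ᵐ u t`); the zoom hypothesis passes to `V t₀`
(`x ↦ λx` preserves null sets); the time translate `v(t) = V(t + t₀/2)` is continuous and BOUNDED on `(−∞,0) × ℝ³`
(`‖V‖ ≤ C/√(−t₀/2)` there), weakly divergence free, Oseen-mild between all pairs (`heatFlow_of_pos`,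
`oseenDuhamel_comp_sub_right`); the Type-I bound gives the uniform weak-`L³` bound along ANY `τ_k → −∞`
(`{s < ‖V τ x‖} ⊆ ball 0 (C₀/s)`, `volume (ball 0 r) = 4πr³/3`) and the heat bound
`√σ ‖e^{σΔ}V(t₀)‖_∞ ≤ A` (split `∫ K_σ(x−y) C₀/‖y‖ dy` at `‖y‖ = √σ`: `K_σ ≤ (4πσ)^{-3/2}`, `∫_{‖y‖<ρ} ‖y‖⁻¹ dy = 2πρ²`,
`∫ K_σ = 1`); the TREE THEOREM `AlbrittonBarker2019_liouville_weakL3_backward_holds` (A–B 2019 Thm 4.1, `ε = 0`) at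
final time `t₀/2` gives `v ≡ 0` for `t ≤ t₀/2`, i.e. `V(t) = 0` for `t ≤ t₀`, hence `u(t) = 0` a.e. Meaning for the
crux: every slice of a witness has a NONZERO distributional limit point under `λ u(t₀, λ·)`, `λ → ∞` — along `λ = cᵏ`
this limit is the blow-up-time trace (N18): a Type-I DSS singularity leaves a scar.
[sources: AlbrittonBarker2019 Thm 4.1, §4 p. 9 (arXiv:1811.00502); tree AncientWeakL3BackwardLiouvilleHolds.lean, HardyPointSinkNoHardyTypeIAncientHardyLargeScale.lean (pattern for the heat bound), StubSmoothRepresentativeAe (p156260)] -/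
theorem stub_noLargeScaleNullSlice :
    ∀ (u : ℝ → EuclideanSpace ℝ (Fin 3) → EuclideanSpace ℝ (Fin 3)) (C₀ : ℝ),
      IsAncientMildSolution 1 u → (∀ t < 0, AEStronglyMeasurable (u t) volume) → HasTypeIDecay C₀ u →
      ∀ t₀ < 0,
        (∀ φ : EuclideanSpace ℝ (Fin 3) → EuclideanSpace ℝ (Fin 3),
          Literature.Analysis.FunctionSpaces.IsTestFunctionOn
            (⊤ : TopologicalSpace.Opens (EuclideanSpace ℝ (Fin 3))) φ →
          Tendsto (fun lam : ℝ => ∫ x, ⟪lam • u t₀ (lam • x), φ x⟫_ℝ) atTop (𝓝 0)) →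
        ∀ t ≤ t₀, u t =ᵐ[volume] 0 :=
  -- LANDED p167789 (lead c17, wave 1)
  _root_.Summit.NavierStokesRegularity.NavierStokesRegularity.Theorems.PolyhedralDssProfileExists.PolyhedralCell.stub_noLargeScaleNullSlice

/-- **Stub N18 — LANDED p168727 (L; worker): the blow-up-time trace of a Type-I ancient solution exists pointwise off the singular
point; for a DSS equivariant field it is DSS-homogeneous of degree −1 and equivariant.** Let `V` be a Type-I
ancient mild field in the Oseen gauge (`IsTypeIAncientMild C V`) with the space–time Type-I bound
`HasTypeIDecay C₀ V`. Then there is `V₀ : ℝ³ → ℝ³` (`V₀ 0 = 0` by convention) such that for every `x ≠ 0`,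
`V(t, x) → V₀(x)` as `t ↑ 0`; `V₀` is continuous on `ℝ³ ∖ {0}`; `‖x‖ ‖V₀ x‖ ≤ C₀`; if `V` is `c`-DSS then
`V₀(cx) = c⁻¹ V₀(x)`; if `V` is `g`-equivariant then so is `V₀`. Proof route: fix `s < 0`; by the Oseen formula
`V t x = heatFlow (V s) (t − s) x − oseenDuhamel 1 s V V t x`; the free part is continuous in `t` up to `t = 0`;
for the Duhamel part substitute `σ = t − τ`:
`oseenDuhamel 1 s V V t x = ∫_{σ ∈ (0, t−s)} ∫ K(σ, x−y)[V(t−σ,y), V(t−σ,y)] dy dσ`, the integrand converges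
pointwise as `t ↑ 0` (joint continuity of `V` on the open past) and is dominated, uniformly in `t < 0`, by
`C_K C₀² (σ + ‖x−y‖²)⁻² ‖y‖⁻²` (`exists_norm_oseenKernel_le`, KochTataruKernel; `‖V(τ,y)‖ ≤ C₀/‖y‖`), which is
integrable on `(0, 1−s) × ℝ³` when `x ≠ 0` (near `y = x`: `∫(σ+‖z‖²)⁻² dz ≲ σ^{-1/2}`; near `y = 0`: `‖y‖⁻²` is locally
integrable; far: `‖y‖⁻⁶`) — dominated convergence (inner in `y`, then outer in `σ` with the moving endpoint
`t − s → −s`). Continuity of `V₀` off `0`: on `ball x₀ (‖x₀‖/2)` the slices are uniformly Lipschitz,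
`‖D V(t)‖ ≤ K/max(‖x‖,√(−t))² ≤ 4K/‖x₀‖²` (`PineauVicol2026.exists_forall_iteratedFDeriv_le_of_typeI 1 C₀` with the
classical pressure of `exists_isClassicalNSSolutionOn_Iio_of_isTypeIAncientMild`, p152134). Homogeneity:
`V(t, cx) = c⁻¹ V(t/c², x)` (`nsRescale c V = V`) and `t/c² ↑ 0`; equivariance: `g` is continuous linear. Meaning: the
DSS singularity has a well-defined velocity trace `u(·, 0) = V₀` on `ℝ³ ∖ {0}`, `|V₀| ≤ C₀/|x|`, log-periodic
homogeneous (`V₀(cᵏx) = c⁻ᵏV₀(x)`), `G`-equivariant — exactly the class of data of the tree's FORWARD DSS theory.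
[sources: KNSS2009 §4 (Oseen formula); KochTataru2001 (14); PineauVicol2026 Lemma 7.1; BradshawTsai2017 (forward DSS data); folklore (dominated convergence)] -/
theorem stub_blowupTrace :
    ∀ (V : ℝ → EuclideanSpace ℝ (Fin 3) → EuclideanSpace ℝ (Fin 3)) (C C₀ : ℝ),
      IsTypeIAncientMild C V → HasTypeIDecay C₀ V →
      ∃ V₀ : EuclideanSpace ℝ (Fin 3) → EuclideanSpace ℝ (Fin 3),
        V₀ 0 = 0 ∧ ContinuousOn V₀ {x | x ≠ 0} ∧
        (∀ x, x ≠ 0 → Tendsto (fun t => V t x) (𝓝[<] 0) (𝓝 (V₀ x))) ∧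
        (∀ x, ‖x‖ * ‖V₀ x‖ ≤ C₀) ∧
        (∀ c : ℝ, 1 < c → IsDiscretelySelfSimilar c V → ∀ x, V₀ (c • x) = c⁻¹ • V₀ x) ∧
        (∀ g : EuclideanSpace ℝ (Fin 3) ≃ₗᵢ[ℝ] EuclideanSpace ℝ (Fin 3),
          (∀ t x, V t (g x) = g (V t x)) → ∀ x, V₀ (g x) = g (V₀ x)) :=
  -- LANDED p168727 (lead c17, wave 1)
  _root_.Summit.NavierStokesRegularity.NavierStokesRegularity.Theorems.PolyhedralDssProfileExists.PolyhedralCell.stub_blowupTrace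

/-- **Stub N19 — LANDED p167727 (M/L; worker): no weak healing at the blow-up time.** Let `(V, p)` be a classical solution of
Navier–Stokes (`ν = 1`, zero force) on the open past with the Type-I bound `HasTypeIDecay C₀ V`. If the slices tend
to zero weakly as `t ↑ 0` — `∫ ⟪V(t,x), φ(x)⟫ dx → 0` for every smooth compactly supported `φ` — then `V ≡ 0` on the
past. Proof route: for `T > 0` the translate `u(t) = V(t − T)` is classical on `(0, T)`; the far-field bounds
`‖Dⁿ V(t)‖ ≤ Kₙ / max(‖x‖, √(−t))^{n+1} ≤ Kₙ` on `{‖x‖ > 1}` for `n ≤ 3`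
(`PineauVicol2026.exists_forall_iteratedFDeriv_le_of_typeI n C₀`, PineauVicolCylinderRegularity) and the weak vanishing
at the final time feed the TREE THEOREM `IsClassicalNSSolutionOn.curl_eq_zero_of_farField_of_tendsto`
(GKPRigidityBackwardUniqueness: ESS backward uniqueness in the far field + unique continuation of the vorticity), so
`curl V(t) ≡ 0` for `t ∈ (T₄ − T, 0)`, every `0 < T₄ < T`; each slice is then `C²`, curl-free, divergence free and
bounded (`≤ C₀/√(−t)`), hence constant (`eq_of_curl_eq_zero_of_isDivFree_of_bounded`, CurlFreeLiouville), hence zero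
(`‖V(t,x)‖ ≤ C₀/‖x‖ → 0`). Meaning for the crux (with A1/p152134 and `∫⟪u t, φ⟫ = ∫⟪V t, φ⟫`): the slices of a
witness do NOT tend weakly to zero at the blow-up time; with N18 and dominated convergence (`‖V(t)‖ ≤ C₀/‖x‖ ∈ L¹_loc`
uniformly) the trace `V₀` is NOT identically zero — a Type-I singularity cannot heal.
[sources: EscauriazaSereginSverak2003 Thm 4.1, Thm 5.1, §5; GallagherKochPlanchon2016 §2.5 (Prop. 2.3, Step D); KNSS2009 Lemma 3.1; tree GKPRigidityBackwardUniqueness.lean, PineauVicolCylinderRegularity.lean, CurlFreeLiouville.lean] -/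
theorem stub_noWeakHealing :
    ∀ (V : ℝ → EuclideanSpace ℝ (Fin 3) → EuclideanSpace ℝ (Fin 3))
      (p : ℝ → EuclideanSpace ℝ (Fin 3) → ℝ) (C₀ : ℝ),
      IsClassicalNSSolutionOn (Set.Iio 0) 1 0 V p → HasTypeIDecay C₀ V →
      (∀ φ : EuclideanSpace ℝ (Fin 3) → EuclideanSpace ℝ (Fin 3),
        Literature.Analysis.FunctionSpaces.IsTestFunctionOn
          (⊤ : TopologicalSpace.Opens (EuclideanSpace ℝ (Fin 3))) φ →
        Tendsto (fun t => ∫ x, ⟪V t x, φ x⟫_ℝ) (𝓝[<] 0) (𝓝 0)) →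
      ∀ t < 0, ∀ x, V t x = 0 :=
  -- LANDED p167727 (lead c17, wave 1)
  _root_.Summit.NavierStokesRegularity.NavierStokesRegularity.Theorems.PolyhedralDssProfileExists.PolyhedralCell.stub_noWeakHealing

/-- **Stub N20 — LANDED p167874 (S/M; worker): axis alignment.** Let `G` be a group of rotations of `ℝ³` (`det = 1`) and `g ∈ G`,
`g ≠ 1`, fixing a nonzero vector `e` (so `ℝe` is the rotation axis of `g`). Then every `G`-equivariant field `w`
(`w(hx) = h w(x)`, `h ∈ G`) is PARALLEL TO THE AXIS ON THE AXIS: `w(re) ∈ ℝe` for all `r`. Proof route: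
`w(re) = w(g(re)) = g w(re)`, so `w(re)` lies in the fixed space of `g`; a linear isometry of `ℝ³` with determinant `1`
other than the identity has a ONE-dimensional fixed space (if `dim Fix(g) ≥ 2`, `g` acts on the invariant line
`Fix(g)ᗮ` by `±1` and `det g = 1` forces `+1`, i.e. `g = 1`), and `e ∈ Fix(g)`, so `Fix(g) = ℝe`. Meaning for the
crux: on each of the 2|G|-ish axis rays of `T/O/I` (through vertices, edge midpoints, face centres) the velocity of a
witness — and every other equivariant vector attached to it (vorticity, `ΔV`, `∂ₜV`, `∇p`) — points along the ray:
the "vortex star" structure of the route thesis, now a theorem usable as a null test.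
[sources: route thesis (Schur / stabilisers); SerreLinearRepresentations1977 §5.3; folklore (fixed space of a rotation); tree StubSchurJet (p156249) for the Fix-space algebra pattern] -/
theorem stub_axisAlignment :
    ∀ (G : Subgroup (EuclideanSpace ℝ (Fin 3) ≃ₗᵢ[ℝ] EuclideanSpace ℝ (Fin 3))),
      (∀ g ∈ G, LinearMap.det (g.toLinearEquiv : EuclideanSpace ℝ (Fin 3) →ₗ[ℝ] EuclideanSpace ℝ (Fin 3)) = 1) →
      ∀ g ∈ G, g ≠ 1 → ∀ e : EuclideanSpace ℝ (Fin 3), e ≠ 0 → g e = e →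
      ∀ w : EuclideanSpace ℝ (Fin 3) → EuclideanSpace ℝ (Fin 3), (∀ h ∈ G, ∀ x, w (h x) = h (w x)) →
      ∀ r : ℝ, ∃ μ : ℝ, w (r • e) = μ • e :=
  -- LANDED p167874 (lead c17, wave 1)
  _root_.Summit.NavierStokesRegularity.NavierStokesRegularity.Theorems.PolyhedralDssProfileExists.PolyhedralCell.stub_axisAlignment

/-- **Stub N21 — LANDED p167665 (S; worker): the ancient Duhamel form (no free part).** For a Type-I ancient mild field in the Oseen
gauge, `‖V(t,x) + B¹_s(V,V)(t)(x)‖ ≤ C/√(−s)` for all `s < t < 0` — the free part `e^{(t−s)Δ}V(s)` of the Oseen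
formula is bounded by `sup |V(s)| ≤ C/√(−s)` (`norm_heatExtension_le_of_bound`, `heatFlow_of_pos`) — hence
`B¹_s(V,V)(t)(x) → −V(t,x)` as `s → −∞`: a Type-I ancient solution IS (minus) its own Duhamel integral from `−∞`,
`V = −B_{−∞}(V,V)`, the quadratic fixed-point form `U = 𝔅(U,U)` of the ∃-hunt (EVENMAP-PROTOCOL §1: "no linear term:
the free evolution from `−∞` of Type-I data vanishes"), now a theorem about witnesses.
[sources: KNSS2009 §4 p. 8 (`u = U + B(u,u)`), §6; tree TypeIAncientMild.lean, HeatExtensionDecay.lean; crux dir EVENMAP-PROTOCOL.md §1] -/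
theorem stub_ancientDuhamel :
    ∀ (V : ℝ → EuclideanSpace ℝ (Fin 3) → EuclideanSpace ℝ (Fin 3)) (C : ℝ),
      IsTypeIAncientMild C V →
      (∀ s t : ℝ, s < t → t < 0 → ∀ x, ‖V t x + oseenDuhamel 1 s V V t x‖ ≤ C / Real.sqrt (-s)) ∧
      (∀ t < 0, ∀ x, Tendsto (fun s => oseenDuhamel 1 s V V t x) atBot (𝓝 (-(V t x)))) :=
  -- LANDED p167665 (lead c17, wave 1)
  _root_.Summit.NavierStokesRegularity.NavierStokesRegularity.Theorems.PolyhedralDssProfileExists.PolyhedralCell.stub_ancientDuhamel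

/-- **Stub N22 — LANDED p168157 (M; worker): the Gaussian-weighted div–curl identity (kinematic).** For a `C²` divergence-free
field `U` on `ℝ³` with polynomial bounds on `U` and `DU`, with the Gaussian `w₀ = e^{−|y|²/4}`:
`∫ w₀ |DU|²_F − ∫ w₀ |curl U|² = ¼ ∫ w₀ (y·U)² − ½ ∫ w₀ |U|²` (`|DU|²_F` = Frobenius norm squared, `frobeniusNormSq`).
Proof route: pointwise `|DU|²_F − |curl U|² = ∑ᵢⱼ ∂ⱼUᵢ ∂ᵢUⱼ` (coordinates, `curl` as defined in VectorCalculus);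
`∫ w₀ ∂ⱼUᵢ∂ᵢUⱼ = −∫ Uᵢ ∂ⱼw₀ ∂ᵢUⱼ − ∫ w₀ Uᵢ ∂ᵢ(div U) = ½ ∫ w₀ yⱼ Uᵢ ∂ᵢUⱼ` (`∇w₀ = −½ y w₀`, `div U = 0`);
`yⱼUᵢ∂ᵢUⱼ = (U·∇)(y·U) − |U|²`; `∫ w₀ (U·∇)(y·U) = −∫ (y·U) (∇w₀·U) = ½ ∫ w₀ (y·U)²`; all whole-space integrations by
parts against the Gaussian via the cut-off pattern of N10's helpers (`integral_cutoff_mul_weight_mul_drift`,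
p161569) with `R → ∞` (Gaussian tails beat the polynomial bounds). Meaning: combined with the landed N10
(`∬w₀|curl U|² = −½∬w₀Π̃(y·U)`) it yields the ENERGY form of the period identity of a witness's Leray orbit,
`∬ w₀ (P + ½|U|²)(y·U) = −2 ∬ w₀ |DU|²_F − ∬ w₀ |U|² < 0` (the `L²(w₀)` energy balance over a period: linear damping
`−‖∇U‖² − ½‖U‖²` exactly compensated by the inward flux of Bernoulli pressure), and slice-wise it converts every
enstrophy statement (N13 floor, N14 sign) into a statement about `|DU|_F`, `y·U` and `|U|`.
[sources: folklore (div–curl identity with weight); Tsai1998 (1.7); PineauVicol2026 (5.4); tree StubGaussianEnstrophyIdentityHelpers (p161569), WholeSpaceIBP.lean, VectorCalculus.lean (`curl`, `frobeniusNormSq`)] -/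
theorem stub_weightedDivCurl :
    ∀ U : EuclideanSpace ℝ (Fin 3) → EuclideanSpace ℝ (Fin 3), ContDiff ℝ 2 U → VectorCalculus.IsDivFree U →
      (∃ K : ℝ, ∃ N : ℕ, ∀ y, ‖U y‖ ≤ K * (1 + ‖y‖) ^ N ∧ ‖fderiv ℝ U y‖ ≤ K * (1 + ‖y‖) ^ N) →
      (∫ y, Real.exp (-‖y‖ ^ 2 / 4) * frobeniusNormSq (fderiv ℝ U y)) -
          ∫ y, Real.exp (-‖y‖ ^ 2 / 4) * ‖curl U y‖ ^ 2 =
        (1 / 4 : ℝ) * (∫ y, Real.exp (-‖y‖ ^ 2 / 4) * ⟪y, U y⟫_ℝ ^ 2) -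
          (1 / 2 : ℝ) * ∫ y, Real.exp (-‖y‖ ^ 2 / 4) * ‖U y‖ ^ 2 :=
  -- LANDED p168157 (lead c17, wave 1)
  _root_.Summit.NavierStokesRegularity.NavierStokesRegularity.Theorems.PolyhedralDssProfileExists.PolyhedralCell.stub_weightedDivCurl

/-! ## Registered stubs of lead c17, wave 2 (N23–N28): structure of the self-similarity group, the trace as a weak
limit / weakly solenoidal field / large-scale limit, vorticity equivariance, the Gaussian ENERGY identity, and the
lead's assembly (portrait III: the scar of a witness) -/

/-- **Stub N23 — LANDED p169279 (M; worker): the self-similarity group of a Type-I ancient solution is infinite cyclic.** Let `V` be a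
Type-I ancient mild field in the Oseen gauge with the space–time Type-I bound, `c`-DSS for some `c > 1`, and not
identically zero. Then there is a MINIMAL factor `c₀ > 1` with `V` `c₀`-DSS, and the positive reals `μ` for which `V`
is `μ`-DSS are exactly the integer powers `c₀ᵏ`, `k ∈ ℤ`. Proof route: `H := {x : ℝ | IsDiscretelySelfSimilar (exp x) V}`
is an additive subgroup of `ℝ` (`nsRescale_one`, `IsDiscretelySelfSimilar.mul`, `nsRescale_inv_nsRescale`); it is
`≠ ⊥` (`log c ∈ H`); by the landed period window N1 (`stub_periodWindow`, p159657, applied to `V`, which is an ancient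
mild solution with measurable slices by `IsTypeIAncientMild.isAncientMildSolution`/`.aestronglyMeasurable_slice`, and
is not a.e. zero on some slice by continuity) there is `c₁ = c₁(C₀) > 1` with NO factor in `(1, c₁)`, i.e.
`Disjoint H (Ioo 0 (log c₁))`; Mathlib `AddSubgroup.exists_isLeast_pos` + `AddSubgroup.cyclic_of_min` give
`H = ℤ b` with least positive `b`; `c₀ := exp b`. Meaning: "the" period `S = 2 log c₀` of a witness's Leray orbit is
well defined and every admissible DSS factor is `c₀ᵐ`; `c₀ ≥ c₁(C₀)` (N1).
[sources: ChaeWolf2017RemovingDSS Thm 1.3 (via tree N1 p159657); folklore (subgroups of ℝ: Mathlib GroupTheory.Archimedean)] -/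
theorem stub_dssGroupCyclic :
    ∀ (V : ℝ → EuclideanSpace ℝ (Fin 3) → EuclideanSpace ℝ (Fin 3)) (C C₀ c : ℝ),
      IsTypeIAncientMild C V → HasTypeIDecay C₀ V → 1 < c → IsDiscretelySelfSimilar c V →
      (∃ t < 0, ∃ x, V t x ≠ 0) →
      ∃ c₀ : ℝ, 1 < c₀ ∧ IsDiscretelySelfSimilar c₀ V ∧
        ∀ μ : ℝ, 0 < μ → (IsDiscretelySelfSimilar μ V ↔ ∃ k : ℤ, μ = c₀ ^ k) :=
  -- LANDED p169279 (lead c17, wave 2)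
  _root_.Summit.NavierStokesRegularity.NavierStokesRegularity.Theorems.PolyhedralDssProfileExists.PolyhedralCell.stub_dssGroupCyclic

/-- **Stub N25 — LANDED p169263 (M; worker): the trace is the weak limit, is locally integrable and weakly solenoidal.** Let `V` be a
Type-I ancient mild field in the Oseen gauge with `HasTypeIDecay C₀ V`, and let `V₀` be its pointwise trace off the
origin (N18: `V(t,x) → V₀(x)` as `t ↑ 0`, `x ≠ 0`). Then `V₀` is locally integrable, weakly divergence free, and
`V(t) ⇀ V₀`: `∫ ⟪V(t), φ⟫ → ∫ ⟪V₀, φ⟫` for every continuous compactly supported `φ`. Proof route: a.e.-strong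
measurability of `V₀` as an a.e. limit along `tₙ ↑ 0` of continuous slices (`aestronglyMeasurable_of_tendsto_ae`); the
domination `‖⟪V t x, φ x⟫‖ ≤ (C₀/‖x‖) ‖φ x‖` (Type-I bound, `‖V t x‖ ≤ C₀/(‖x‖+√(−t)) ≤ C₀/‖x‖`), integrable since
`‖x‖⁻¹` is locally integrable in `ℝ³` (`NewtonPotentialHolder.integrableOn_ball_norm_rpow_neg`, used in N18's file);
dominated convergence along `𝓝[<] 0` (`tendsto_integral_filter_of_dominated_convergence`); `‖V₀ x‖ ≤ C₀/‖x‖` in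
the limit gives local integrability; weak solenoidality: `∫⟪V t, ∇θ⟫ = 0` for every `t < 0` (smooth divergence-free
slices are weakly divergence free) passes to the limit. Meaning: the scar `V₀` is an honest `L¹_loc ∩ L^{3,∞}`,
weakly divergence-free, (−1)-DSS-homogeneous datum at the blow-up time — data of the tree's forward DSS theory.
[sources: folklore (DCT); KNSS2009 §4; tree StubBlowupTrace (p168727), VectorCalculus (`IsWeaklyDivFree`)] -/
theorem stub_traceWeakLimit :
    ∀ (V : ℝ → EuclideanSpace ℝ (Fin 3) → EuclideanSpace ℝ (Fin 3)) (C C₀ : ℝ)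
      (V₀ : EuclideanSpace ℝ (Fin 3) → EuclideanSpace ℝ (Fin 3)),
      IsTypeIAncientMild C V → HasTypeIDecay C₀ V →
      (∀ x, x ≠ 0 → Tendsto (fun t => V t x) (𝓝[<] 0) (𝓝 (V₀ x))) →
      LocallyIntegrable V₀ volume ∧ IsWeaklyDivFree V₀ ∧
      (∀ φ : EuclideanSpace ℝ (Fin 3) → EuclideanSpace ℝ (Fin 3), Continuous φ → HasCompactSupport φ →
        Tendsto (fun t => ∫ x, ⟪V t x, φ x⟫_ℝ) (𝓝[<] 0) (𝓝 (∫ x, ⟪V₀ x, φ x⟫_ℝ))) :=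
  -- LANDED p169263 (lead c17, wave 2)
  _root_.Summit.NavierStokesRegularity.NavierStokesRegularity.Theorems.PolyhedralDssProfileExists.PolyhedralCell.stub_traceWeakLimit

/-- **Stub N26 — LANDED p169415 (M/L; worker): vorticity is equivariant under proper rotations.** For a linear isometry `g` of `ℝ³`
with `det g = 1` and a differentiable `g`-equivariant field `w` (`w(gx) = g w(x)`): `curl w (g x) = g (curl w x)`.
Proof route: chain rule `D(w ∘ g)(x) = Dw(gx) ∘ g` and `w ∘ g = g ∘ w` give `Dw(gx) = g ∘ Dw(x) ∘ g⁻¹`; the axial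
vector of a conjugated matrix: `curlCLM (g A g⁻¹) = g (curlCLM A)` for `g ∈ SO(3)` (coordinates: with
`ε_{ijk} g_{ia} g_{jb} g_{kc} = det g · ε_{abc}` — `fin_cases` + `Matrix.det_fin_three` + `ring` — and `g⁻¹ = gᵀ`);
the tree has the `rotZ` case (`curlCLM_rotZL_conj`, AxisymmetricVorticityTransport; `curl_rotZ_conj`,
PineauVicolEnstrophyTime) as the pattern. Meaning (with N20): on every rotation axis of `G` the VORTICITY of a witness
is parallel to the axis too ("u ∥ ω ∥ e on the 14/26/62 axis rays"), and `curl` maps `G`-equivariant fields to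
`G`-equivariant fields (used implicitly by every symmetric-sector computation).
[sources: folklore (pseudo-vectors under SO(3)); MajdaBertozzi2002 §1.2; tree AxisymmetricVorticityTransport.lean:164, VectorCalculus.lean (`curl`, `curlCLM`)] -/
theorem stub_curlEquivariant :
    ∀ (g : EuclideanSpace ℝ (Fin 3) ≃ₗᵢ[ℝ] EuclideanSpace ℝ (Fin 3)),
      LinearMap.det (g.toLinearEquiv : EuclideanSpace ℝ (Fin 3) →ₗ[ℝ] EuclideanSpace ℝ (Fin 3)) = 1 →
      ∀ w : EuclideanSpace ℝ (Fin 3) → EuclideanSpace ℝ (Fin 3), Differentiable ℝ w →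
        (∀ x, w (g x) = g (w x)) → ∀ x, curl w (g x) = g (curl w x) :=
  -- LANDED p169415 (lead c17, wave 2)
  _root_.Summit.NavierStokesRegularity.NavierStokesRegularity.Theorems.PolyhedralDssProfileExists.PolyhedralCell.stub_curlEquivariant

/-- **Stub N27 — LANDED p169227 (S/M; worker): along the DSS scales, the large-scale limit of EVERY slice is the blow-up trace.** Let
`V` be jointly continuous on the open past, `c`-DSS (`c > 1`), and let `V₀` be a field with `V(t) ⇀ V₀` as `t ↑ 0`
(against continuous compactly supported `φ`; N25). Then for every `t₀ < 0` and every such `φ`,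
`∫ ⟪cᵏ V(t₀, cᵏx), φ(x)⟫ dx → ∫ ⟪V₀, φ⟫` as `k → ∞`. Proof route: iterating `nsRescale c V = V`
(`IsDiscretelySelfSimilar.mul`, induction on `k`) gives `cᵏ • V t₀ (cᵏ • x) = V (t₀ / c^(2k)) x`; and
`t₀ / c^(2k) → 0⁻` (`tendsto_pow_atTop_atTop_of_one_lt`, within `Iio 0` since `t₀ < 0`), so compose the weak
convergence with this sequence (`Tendsto.comp`, `tendsto_nhdsWithin_iff`). Meaning: closes the circle N17 ↔ N18/N19:
Albritton–Barker's zoom limit of any slice of a witness IS the scar `V₀` (in particular the zooms do not tend to `0`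
iff `V₀ ≢ 0`).
[sources: folklore; ChaeWolf2017RemovingDSS Def. 1.1; tree SelfSimilar.lean (`nsRescale`, `IsDiscretelySelfSimilar`)] -/
theorem stub_zoomLimitIsTrace :
    ∀ (V : ℝ → EuclideanSpace ℝ (Fin 3) → EuclideanSpace ℝ (Fin 3)) (c : ℝ)
      (V₀ : EuclideanSpace ℝ (Fin 3) → EuclideanSpace ℝ (Fin 3)),
      1 < c → IsDiscretelySelfSimilar c V →
      (∀ φ : EuclideanSpace ℝ (Fin 3) → EuclideanSpace ℝ (Fin 3), Continuous φ → HasCompactSupport φ →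
        Tendsto (fun t => ∫ x, ⟪V t x, φ x⟫_ℝ) (𝓝[<] 0) (𝓝 (∫ x, ⟪V₀ x, φ x⟫_ℝ))) →
      ∀ t₀ < 0, ∀ φ : EuclideanSpace ℝ (Fin 3) → EuclideanSpace ℝ (Fin 3), Continuous φ → HasCompactSupport φ →
        Tendsto (fun k : ℕ => ∫ x, ⟪(c ^ k) • V t₀ ((c ^ k) • x), φ x⟫_ℝ) atTop (𝓝 (∫ x, ⟪V₀ x, φ x⟫_ℝ)) :=
  -- LANDED p169227 (lead c17, wave 2)
  _root_.Summit.NavierStokesRegularity.NavierStokesRegularity.Theorems.PolyhedralDssProfileExists.PolyhedralCell.stub_zoomLimitIsTrace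

/-- **Stub N28 — LANDED p169298 (M/L; worker): the Gaussian ENERGY identity of a periodic backward-Leray orbit.** Under exactly the
hypotheses of N10 (`stub_gaussianEnstrophyIdentity`, p162020: classical backward Leray system on `ℝ × ℝ³`, `S`-periodic,
polynomial bounds on `U`, `DU`, `∂ₛU`, `P`, `∇P`), with `w₀ = e^{−|y|²/4}`:
`∫₀^S∫ w₀ (P + ½|U|²)(y·U) = −2 ∫₀^S∫ w₀ |DU|²_F − ∫₀^S∫ w₀ |U|²`. Proof route: N10 gives
`∬w₀|curl U|² = −½∬w₀(P + ½|U|² + ½ y·U)(y·U)`; the landed slice identity N22 (`stub_weightedDivCurl`, p168157; each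
slice `U s` is `C²` — `IsBackwardLeraySolutionOn` carries joint smoothness — divergence free, with the polynomial
bounds) gives `∫w₀|curl U(s)|² = ∫w₀|DU(s)|²_F − ¼∫w₀(y·U)² + ½∫w₀|U|²` for every `s`; integrate over `(0,S)`
(interval-integral linearity; integrability in `s` of the slice integrals from continuity in `s` of Gaussian-dominated
parametric integrals, or from measurability + uniform bounds) and cancel the `¼∬w₀(y·U)²` terms. Meaning: the `L²(w₀)`
ENERGY balance of the orbit over a period — linear damping `−∬w₀|DU|²_F − ½∬w₀|U|²` is exactly compensated by the
inward Gaussian flux of the Bernoulli pressure `P + ½|U|²`; with N14 both correlations `∬w₀Π̃(y·U)` and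
`∬w₀(P+½|U|²)(y·U)` are strictly negative for a nontrivial orbit.
[sources: Tsai1998 (1.7); PineauVicol2026 (5.4); tree N10 (p162020), N22 (p168157)] -/
theorem stub_gaussianEnergyIdentity :
    ∀ (U : ℝ → EuclideanSpace ℝ (Fin 3) → EuclideanSpace ℝ (Fin 3)) (P : ℝ → EuclideanSpace ℝ (Fin 3) → ℝ)
      (S : ℝ), 0 < S → IsBackwardLeraySolutionOn Set.univ 1 U P → Function.Periodic U S →
      (∃ K : ℝ, ∃ N : ℕ, ∀ s y,
          ‖U s y‖ ≤ K * (1 + ‖y‖) ^ N ∧ ‖fderiv ℝ (U s) y‖ ≤ K * (1 + ‖y‖) ^ N ∧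
          ‖timeDeriv U s y‖ ≤ K * (1 + ‖y‖) ^ N ∧ |P s y| ≤ K * (1 + ‖y‖) ^ N ∧
          ‖gradient (P s) y‖ ≤ K * (1 + ‖y‖) ^ N) →
      ∫ s in (0 : ℝ)..S, ∫ y, Real.exp (-‖y‖ ^ 2 / 4) * ((P s y + ‖U s y‖ ^ 2 / 2) * ⟪y, U s y⟫_ℝ) =
        -(2 : ℝ) * (∫ s in (0 : ℝ)..S, ∫ y, Real.exp (-‖y‖ ^ 2 / 4) * frobeniusNormSq (fderiv ℝ (U s) y)) -
          ∫ s in (0 : ℝ)..S, ∫ y, Real.exp (-‖y‖ ^ 2 / 4) * ‖U s y‖ ^ 2 :=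
  -- LANDED p169298 (lead c17, wave 2)
  _root_.Summit.NavierStokesRegularity.NavierStokesRegularity.Theorems.PolyhedralDssProfileExists.PolyhedralCell.stub_gaussianEnergyIdentity

/-- **Stub N24 — LANDED p169435 (M; LEAD): the portrait of a witness, III — its SCAR.** Every witness `(G, c, u, C₀)` of the crux (no
finiteness, determinant or irreducibility needed) has an Oseen-gauge representative `V` (A1/A2, classical pressure
p152134) with a blow-up-time trace `V₀` (N18) that is continuous off the origin, bounded by `C₀/|x|`, `c`-DSS-homogeneous
of degree −1, `G`-equivariant, locally integrable, weakly divergence free and NOT IDENTICALLY ZERO; the slices of `V`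
converge weakly to `V₀` and do NOT tend weakly to zero (N19), NO slice is null at large scales (N17 with N4), along the
DSS scales the large-scale limit of every slice is `V₀` (N27), and `V` is minus its own Duhamel integral from `−∞`
(N21). Assembly of the landed A1 p156260, A2 p155960, p152134, N4 p159754, N17 p167789, N18 p168727, N19 p167727,
N21 p167665 and the wave-2 stubs N25, N27. [sources: the cited stubs; folklore] -/
theorem stub_witnessPortraitIII :
    ∀ (G : Subgroup (EuclideanSpace ℝ (Fin 3) ≃ₗᵢ[ℝ] EuclideanSpace ℝ (Fin 3))) (c : ℝ)
      (u : ℝ → EuclideanSpace ℝ (Fin 3) → EuclideanSpace ℝ (Fin 3)) (C₀ : ℝ),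
      1 < c → IsAncientMildSolution 1 u → (∀ t < 0, AEStronglyMeasurable (u t) volume) →
      IsDiscretelySelfSimilar c u → HasTypeIDecay C₀ u → (∀ g ∈ G, ∀ t x, u t (g x) = g (u t x)) →
      ¬ (∀ t < 0, u t =ᵐ[volume] 0) →
      ∃ (V : ℝ → EuclideanSpace ℝ (Fin 3) → EuclideanSpace ℝ (Fin 3)) (C : ℝ)
        (p : ℝ → EuclideanSpace ℝ (Fin 3) → ℝ) (V₀ : EuclideanSpace ℝ (Fin 3) → EuclideanSpace ℝ (Fin 3)),
        IsTypeIAncientMild C V ∧ HasTypeIDecay C₀ V ∧ (∀ t < 0, V t =ᵐ[volume] u t) ∧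
        IsDiscretelySelfSimilar c V ∧ (∀ g ∈ G, ∀ t x, V t (g x) = g (V t x)) ∧
        IsClassicalNSSolutionOn (Set.Iio 0) 1 0 V p ∧
        V₀ 0 = 0 ∧ ContinuousOn V₀ {x | x ≠ 0} ∧
        (∀ x, x ≠ 0 → Tendsto (fun t => V t x) (𝓝[<] 0) (𝓝 (V₀ x))) ∧
        (∀ x, ‖x‖ * ‖V₀ x‖ ≤ C₀) ∧ (∀ x, V₀ (c • x) = c⁻¹ • V₀ x) ∧ (∀ g ∈ G, ∀ x, V₀ (g x) = g (V₀ x)) ∧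
        LocallyIntegrable V₀ volume ∧ IsWeaklyDivFree V₀ ∧
        (∀ φ : EuclideanSpace ℝ (Fin 3) → EuclideanSpace ℝ (Fin 3), Continuous φ → HasCompactSupport φ →
          Tendsto (fun t => ∫ x, ⟪V t x, φ x⟫_ℝ) (𝓝[<] 0) (𝓝 (∫ x, ⟪V₀ x, φ x⟫_ℝ))) ∧
        (∃ x, V₀ x ≠ 0) ∧
        ¬ (∀ φ : EuclideanSpace ℝ (Fin 3) → EuclideanSpace ℝ (Fin 3),
            Literature.Analysis.FunctionSpaces.IsTestFunctionOn
              (⊤ : TopologicalSpace.Opens (EuclideanSpace ℝ (Fin 3))) φ →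
            Tendsto (fun t => ∫ x, ⟪V t x, φ x⟫_ℝ) (𝓝[<] 0) (𝓝 0)) ∧
        (∀ t₀ < 0, ¬ (∀ φ : EuclideanSpace ℝ (Fin 3) → EuclideanSpace ℝ (Fin 3),
            Literature.Analysis.FunctionSpaces.IsTestFunctionOn
              (⊤ : TopologicalSpace.Opens (EuclideanSpace ℝ (Fin 3))) φ →
            Tendsto (fun lam : ℝ => ∫ x, ⟪lam • V t₀ (lam • x), φ x⟫_ℝ) atTop (𝓝 0))) ∧
        (∀ t₀ < 0, ∀ φ : EuclideanSpace ℝ (Fin 3) → EuclideanSpace ℝ (Fin 3), Continuous φ → HasCompactSupport φ →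
          Tendsto (fun k : ℕ => ∫ x, ⟪(c ^ k) • V t₀ ((c ^ k) • x), φ x⟫_ℝ) atTop (𝓝 (∫ x, ⟪V₀ x, φ x⟫_ℝ))) ∧
        (∀ t < 0, ∀ x, Tendsto (fun s => oseenDuhamel 1 s V V t x) atBot (𝓝 (-(V t x)))) :=
  -- LANDED p169435 (lead c17, wave 2)
  _root_.Summit.NavierStokesRegularity.NavierStokesRegularity.Theorems.PolyhedralDssProfileExists.PolyhedralCell.stub_witnessPortraitIII

/-! ## Registered stubs of lead c17, wave 3 (N29–N34): regularity of the scar, the weak div–curl Liouville theorem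
with `|x|⁻¹` bound, the weak curl of the scar, the scar as forward-DSS datum, the far field of every slice -/

/-- **Stub N29 — LANDED p170122 (L; worker): the scar is `C¹` off the origin and the velocity GRADIENTS converge.** Let `V` be a Type-I
ancient mild field in the Oseen gauge with `HasTypeIDecay C₀ V` and pointwise trace `V₀` off the origin (N18). Then
`V₀` is differentiable on `ℝ³ ∖ {0}` with continuous derivative there, `DV(t,x) → DV₀(x)` and
`curl V(t,x) → curl V₀(x)` as `t ↑ 0` for every `x ≠ 0`, and `‖x‖² ‖DV₀(x)‖ ≤ K` for a constant `K` (junk `DV₀(0)`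
harmless). Proof route (no Arzelà–Ascoli): classical pressure (`exists_isClassicalNSSolutionOn_Iio_of_isTypeIAncientMild`)
and `PineauVicol2026.exists_forall_iteratedFDeriv_le_of_typeI n C₀`, `n = 1, 2`: on `B = ball x₀ (‖x₀‖/2)` (convex,
off `0`) the slices satisfy `‖DV(t)‖ ≤ K₁'`, `‖D²V(t)‖ ≤ K₂'` uniformly in `t < 0`. Taylor:
`‖V(t,x+h) − V(t,x) − DV(t,x)h‖ ≤ K₂'‖h‖²/2`; hence for the basis directions `eᵢ` and `δ > 0`,
`‖DV(t,x)eᵢ − DV(t',x)eᵢ‖ ≤ (‖V(t,x+δeᵢ)−V(t',x+δeᵢ)‖ + ‖V(t,x)−V(t',x)‖)/δ + K₂'δ`, so (pointwise convergence of `V`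
at the four points `x, x+δeᵢ`) `DV(t,x)` is Cauchy as `t ↑ 0` and converges to some `L(x)`; passing to the limit in
the Taylor estimate, `‖V₀(x+h) − V₀(x) − L(x)h‖ ≤ K₂'‖h‖²/2`, i.e. `HasFDerivAt V₀ (L x) x`; `L` is a pointwise limit of
`K₂'`-Lipschitz maps, hence Lipschitz, hence continuous on `B`; `curl` is a continuous linear function of the
derivative (`curl_eq_curlCLM`); the bound from `‖DV(t,x)‖ ≤ K₁/max(‖x‖,√(−t))² ≤ K₁/‖x‖²`. Meaning: the VORTICITY
TRACE `ω₀ = curl V₀ = lim_{t↑0} curl V(t,·)` exists off the origin, `|ω₀| ≲ |x|⁻²`, (−2)-DSS-homogeneous, equivariant.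
[sources: PineauVicol2026 Lemma 7.1 (tree); folklore (Taylor/Cauchy argument); tree StubBlowupTrace (p168727)] -/
theorem stub_traceC1 :
    ∀ (V : ℝ → EuclideanSpace ℝ (Fin 3) → EuclideanSpace ℝ (Fin 3)) (C C₀ : ℝ)
      (V₀ : EuclideanSpace ℝ (Fin 3) → EuclideanSpace ℝ (Fin 3)),
      IsTypeIAncientMild C V → HasTypeIDecay C₀ V →
      (∀ x, x ≠ 0 → Tendsto (fun t => V t x) (𝓝[<] 0) (𝓝 (V₀ x))) →
      DifferentiableOn ℝ V₀ {x | x ≠ 0} ∧ ContinuousOn (fderiv ℝ V₀) {x | x ≠ 0} ∧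
      (∀ x, x ≠ 0 → Tendsto (fun t => fderiv ℝ (V t) x) (𝓝[<] 0) (𝓝 (fderiv ℝ V₀ x))) ∧
      (∀ x, x ≠ 0 → Tendsto (fun t => curl (V t) x) (𝓝[<] 0) (𝓝 (curl V₀ x))) ∧
      (∃ K : ℝ, ∀ x, ‖x‖ ^ 2 * ‖fderiv ℝ V₀ x‖ ≤ K) :=
  -- LANDED p170122 (lead c17, wave 3)
  _root_.Summit.NavierStokesRegularity.NavierStokesRegularity.Theorems.PolyhedralDssProfileExists.PolyhedralCell.stub_traceC1

/-- **Stub N30 — LANDED p169998 (M/L; worker): the weak div–curl Liouville theorem with an `|x|⁻¹` envelope.** A locally integrable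
field `W` on `ℝ³` which is weakly divergence free AND weakly curl free (`∫⟪W, curl ψ⟫ = 0` for every smooth compactly
supported `ψ`) and satisfies `‖W x‖ ≤ C/‖x‖` for a.e. `x` vanishes a.e. Proof route (mollify + the tree's bounded
div–curl Liouville): for a smooth bump `ρ_ε` the convolution `W_ε = W ⋆ ρ_ε` is smooth
(`HasCompactSupport.contDiff_convolution_right`), divergence free and curl free POINTWISE (differentiate under the
integral, `HasCompactSupport.hasFDerivAt_convolution_right`, and feed the weak identities with the tests
`y ↦ ρ_ε(x − y)`), and BOUNDED (`‖W_ε x‖ ≤ ‖ρ_ε‖_∞ ∫_{ball x ε} C/‖y‖ dy ≤ ‖ρ_ε‖_∞ ∫_{ball 0 ε} C/‖y‖ dy < ∞` — or more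
simply `≤ 2C/‖x‖` for `‖x‖ ≥ 2ε` and a crude local bound inside); so `W_ε` is constant
(`eq_of_curl_eq_zero_of_isDivFree_of_bounded`, CurlFreeLiouville) and the constant is `0` (`‖W_ε x‖ ≤ 2C/‖x‖ → 0`);
finally `W_ε → W` a.e. as `ε → 0` (`ContDiffBump.ae_convolution_tendsto_right_of_locallyIntegrable`). Meaning (with
N25, N29, N31): the vorticity trace `ω₀` of a witness cannot vanish identically — if it did, `V₀` would be weakly
curl free (N31) and weakly divergence free (N25) with `|V₀| ≤ C₀/|x|`, hence `0`, contradicting portrait III.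
[sources: folklore (Weyl/mollification); KNSS2009 Lemma 3.1; tree CurlFreeLiouville.lean, Mathlib Analysis.Convolution / BumpFunction] -/
theorem stub_weakDivCurlLiouville :
    ∀ (W : EuclideanSpace ℝ (Fin 3) → EuclideanSpace ℝ (Fin 3)) (C : ℝ),
      LocallyIntegrable W volume → IsWeaklyDivFree W →
      (∀ ψ : EuclideanSpace ℝ (Fin 3) → EuclideanSpace ℝ (Fin 3),
        Literature.Analysis.FunctionSpaces.IsTestFunctionOn
          (⊤ : TopologicalSpace.Opens (EuclideanSpace ℝ (Fin 3))) ψ →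
        ∫ x, ⟪W x, curl ψ x⟫_ℝ = 0) →
      (∀ᵐ x ∂volume, ‖W x‖ ≤ C / ‖x‖) →
      W =ᵐ[volume] 0 :=
  -- LANDED p169998 (lead c17, wave 3)
  _root_.Summit.NavierStokesRegularity.NavierStokesRegularity.Theorems.PolyhedralDssProfileExists.PolyhedralCell.stub_weakDivCurlLiouville

/-- **Stub N31 — LANDED p170209 (M/L; worker): the weak curl of the scar is its pointwise curl (the origin carries no vorticity
mass).** Let `V₀ : ℝ³ → ℝ³` be differentiable on `ℝ³ ∖ {0}` with continuous derivative there, with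
`‖x‖ ‖V₀ x‖ ≤ C₀` and `‖x‖² ‖DV₀ x‖ ≤ K`. Then for every smooth compactly supported `ψ`,
`∫ ⟪V₀, curl ψ⟫ = ∫ ⟪curl V₀, ψ⟫`. Proof route: with a radial cut-off `χ_ε(x) = χ(‖x‖/ε)` vanishing near `0` and `= 1`
for `‖x‖ ≥ 2ε`: `∫ χ_ε (⟪V₀, curl ψ⟫ − ⟪curl V₀, ψ⟫) = ∫ χ_ε div(ψ × V₀) = −∫ ⟪∇χ_ε, ψ × V₀⟫ = O(∫_{ε<‖x‖<2ε} ε⁻¹ C₀/‖x‖) = O(ε)`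
(`div (A × B) = ⟪B, curl A⟫ − ⟪A, curl B⟫`; whole-space integration by parts of the compactly supported `C¹` field
`χ_ε ψ × V₀`, e.g. `integral_mul_divergence_add_eq_zero_of_integrable`-type lemmas of WholeSpaceIBP(Integrable).lean,
or coordinatewise `integral_mul_fderiv_eq_neg_fderiv_mul`); let `ε → 0` by dominated convergence (`‖curl V₀‖ ≲ K/‖x‖²`
and `C₀/‖x‖` are locally integrable in `ℝ³`). If the cross-product bookkeeping is inconvenient, prove the coordinate
form `∫ (V₀)ᵢ ∂ⱼψₖ` vs `−∫ ∂ⱼ(V₀)ᵢ ψₖ` with the cut-off and assemble the six terms of `curl`.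
[sources: folklore; MajdaBertozzi2002 §1.2; tree WholeSpaceIBP*.lean, VectorCalculus.lean (`curl`), NewtonPotentialHolder (`integrableOn_ball_norm_rpow_neg`)] -/
theorem stub_traceCurlWeak :
    ∀ (V₀ : EuclideanSpace ℝ (Fin 3) → EuclideanSpace ℝ (Fin 3)) (C₀ K : ℝ),
      DifferentiableOn ℝ V₀ {x | x ≠ 0} → ContinuousOn (fderiv ℝ V₀) {x | x ≠ 0} →
      (∀ x, ‖x‖ * ‖V₀ x‖ ≤ C₀) → (∀ x, ‖x‖ ^ 2 * ‖fderiv ℝ V₀ x‖ ≤ K) →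
      ∀ ψ : EuclideanSpace ℝ (Fin 3) → EuclideanSpace ℝ (Fin 3),
        Literature.Analysis.FunctionSpaces.IsTestFunctionOn
          (⊤ : TopologicalSpace.Opens (EuclideanSpace ℝ (Fin 3))) ψ →
        ∫ x, ⟪V₀ x, curl ψ x⟫_ℝ = ∫ x, ⟪curl V₀ x, ψ x⟫_ℝ :=
  -- LANDED p170209 (lead c17, wave 3)
  _root_.Summit.NavierStokesRegularity.NavierStokesRegularity.Theorems.PolyhedralDssProfileExists.PolyhedralCell.stub_traceCurlWeak

/-- **Stub N32 — LANDED p169703 (S/M; worker): the scar is admissible forward-DSS datum — the blow-up continues as a forward DSS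
expander.** Let `V₀ : ℝ³ → ℝ³` be a.e.-strongly measurable, weakly divergence free, with `‖x‖ ‖V₀ x‖ ≤ C₀` and
DSS-homogeneous `V₀(cx) = c⁻¹ V₀(x)` (`c > 1`). Then there is a FORWARD `c`-DSS local Leray solution `(v, π)` of
Navier–Stokes on `(0, ∞) × ℝ³` with initial datum `V₀`. Proof route: `V₀ ∈ L^{3,∞}` (`{σ < ‖V₀‖} ⊆ ball 0 (C₀/σ)`,
`memWeakLp_three_of_forall`, AncientWeakL3BackwardLiouvilleAssembly), `nsRescaleData c V₀ = V₀`
(`nsRescaleData_apply : nsRescaleData c u₀ x = c • u₀ (c • x)`), and the TREE THEOREM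
`bradshawTsai2017_dss_localLeray_existence_holds` (Bradshaw–Tsai, AHP 2017, Thm 1.2). Meaning: glued to the witness,
`u` on `t < 0` and `v` on `t > 0` form a `c`-DSS field on `ℝ × ℝ³` with the single singular point `(0,0)` and the
scar as the common trace — the DSS "reflection through the singularity" picture is available for every witness.
[sources: BradshawTsai2017AHP Thm 1.2 (tree theorem); BradshawTsai2019 Lemma 4.1; JiaSverak2014 (−1-homogeneous data)] -/
theorem stub_scarForwardDss :
    ∀ (V₀ : EuclideanSpace ℝ (Fin 3) → EuclideanSpace ℝ (Fin 3)) (C₀ c : ℝ),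
      AEStronglyMeasurable V₀ volume → IsWeaklyDivFree V₀ → (∀ x, ‖x‖ * ‖V₀ x‖ ≤ C₀) →
      1 < c → (∀ x, V₀ (c • x) = c⁻¹ • V₀ x) →
      ∃ (v : ℝ → EuclideanSpace ℝ (Fin 3) → EuclideanSpace ℝ (Fin 3)) (π : ℝ → EuclideanSpace ℝ (Fin 3) → ℝ),
        IsLocalLeraySolution 1 V₀ v π ∧ IsDiscretelySelfSimilar c v :=
  -- LANDED p169703 (lead c17, wave 3)
  _root_.Summit.NavierStokesRegularity.NavierStokesRegularity.Theorems.PolyhedralDssProfileExists.PolyhedralCell.stub_scarForwardDss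

/-- **Stub N34 — LANDED p169689 (S; worker): the far field of EVERY slice of a witness is the scar.** For a `c`-DSS field `V` with
pointwise trace `V₀` off the origin: `cᵏ V(t, cᵏx) → V₀(x)` as `k → ∞`, for every `t < 0` and `x ≠ 0` — the spatial
asymptotics of each slice along the DSS lattice `|x| cᵏ` is `V₀`: in Leray variables the profile has the far field
`|y|⁻¹ σ` with `σ` = the scar read on the unit shell (EVENMAP-PROTOCOL §3(i), now a theorem about witnesses).
Proof route: `cᵏ • V t (cᵏ • x) = V (t / (cᵏ)²) x` (iterate `nsRescale c V = V`; tree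
`BradshawTsai2019.isDiscretelySelfSimilar_pow` / N27's helper `zoomLimitIsTrace_zoom_eq`) and `t/(cᵏ)² ↑ 0` within
`Iio 0` (N27's helper `zoomLimitIsTrace_tendsto_time`); compose with the pointwise convergence at `x`.
[sources: folklore; ChaeWolf2017RemovingDSS Def. 1.1; tree StubZoomLimitIsTrace (p169227)] -/
theorem stub_farFieldIsTrace :
    ∀ (V : ℝ → EuclideanSpace ℝ (Fin 3) → EuclideanSpace ℝ (Fin 3)) (c : ℝ)
      (V₀ : EuclideanSpace ℝ (Fin 3) → EuclideanSpace ℝ (Fin 3)),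
      1 < c → IsDiscretelySelfSimilar c V →
      (∀ x, x ≠ 0 → Tendsto (fun t => V t x) (𝓝[<] 0) (𝓝 (V₀ x))) →
      ∀ t < 0, ∀ x, x ≠ 0 → Tendsto (fun k : ℕ => (c ^ k) • V t ((c ^ k) • x)) atTop (𝓝 (V₀ x)) :=
  -- LANDED p169689 (lead c17, wave 3)
  _root_.Summit.NavierStokesRegularity.NavierStokesRegularity.Theorems.PolyhedralDssProfileExists.PolyhedralCell.stub_farFieldIsTrace

/-- **Stub N33 — LANDED p170418 (M; LEAD): the portrait of a witness, IV — the VORTICITY SCAR, its symmetry, the forward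
continuation.** For witnesses with `G` a group of rotations (`det = 1`): the representative `V` and trace `V₀` of
portrait III satisfy moreover — `V₀ ∈ C¹(ℝ³∖{0})` with `|x|²|DV₀| ≤ K` and `curl V(t,·) → curl V₀` pointwise off `0`
(N29); the distributional curl of `V₀` is its pointwise curl (N31); the vorticity scar `ω₀ = curl V₀` is NOT identically
zero (else N30 with N25 forces `V₀ = 0`, contradicting portrait III), is `G`-equivariant (N26 + limit) and
DSS-homogeneous of degree −2; on every rotation axis of `G` both `V₀` and `ω₀` point along the axis (N20); and the blow-up
continues from the scar as a forward `c`-DSS local Leray solution (N32). Assembly of N24, N29, N30, N31, N32, N20, N26.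
[sources: the cited stubs; folklore] -/
theorem stub_witnessPortraitIV :
    ∀ (G : Subgroup (EuclideanSpace ℝ (Fin 3) ≃ₗᵢ[ℝ] EuclideanSpace ℝ (Fin 3))) (c : ℝ)
      (u : ℝ → EuclideanSpace ℝ (Fin 3) → EuclideanSpace ℝ (Fin 3)) (C₀ : ℝ),
      (∀ g ∈ G, LinearMap.det (g.toLinearEquiv : EuclideanSpace ℝ (Fin 3) →ₗ[ℝ] EuclideanSpace ℝ (Fin 3)) = 1) →
      1 < c → IsAncientMildSolution 1 u → (∀ t < 0, AEStronglyMeasurable (u t) volume) →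
      IsDiscretelySelfSimilar c u → HasTypeIDecay C₀ u → (∀ g ∈ G, ∀ t x, u t (g x) = g (u t x)) →
      ¬ (∀ t < 0, u t =ᵐ[volume] 0) →
      ∃ (V : ℝ → EuclideanSpace ℝ (Fin 3) → EuclideanSpace ℝ (Fin 3)) (C : ℝ)
        (p : ℝ → EuclideanSpace ℝ (Fin 3) → ℝ) (V₀ : EuclideanSpace ℝ (Fin 3) → EuclideanSpace ℝ (Fin 3)),
        IsTypeIAncientMild C V ∧ HasTypeIDecay C₀ V ∧ (∀ t < 0, V t =ᵐ[volume] u t) ∧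
        IsDiscretelySelfSimilar c V ∧ (∀ g ∈ G, ∀ t x, V t (g x) = g (V t x)) ∧
        IsClassicalNSSolutionOn (Set.Iio 0) 1 0 V p ∧
        V₀ 0 = 0 ∧ (∀ x, x ≠ 0 → Tendsto (fun t => V t x) (𝓝[<] 0) (𝓝 (V₀ x))) ∧
        (∀ x, ‖x‖ * ‖V₀ x‖ ≤ C₀) ∧ (∀ x, V₀ (c • x) = c⁻¹ • V₀ x) ∧ (∀ g ∈ G, ∀ x, V₀ (g x) = g (V₀ x)) ∧
        (∃ x, V₀ x ≠ 0) ∧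
        DifferentiableOn ℝ V₀ {x | x ≠ 0} ∧ ContinuousOn (fderiv ℝ V₀) {x | x ≠ 0} ∧
        (∀ x, x ≠ 0 → Tendsto (fun t => curl (V t) x) (𝓝[<] 0) (𝓝 (curl V₀ x))) ∧
        (∃ K : ℝ, ∀ x, ‖x‖ ^ 2 * ‖fderiv ℝ V₀ x‖ ≤ K) ∧
        (∀ ψ : EuclideanSpace ℝ (Fin 3) → EuclideanSpace ℝ (Fin 3),
          Literature.Analysis.FunctionSpaces.IsTestFunctionOn
            (⊤ : TopologicalSpace.Opens (EuclideanSpace ℝ (Fin 3))) ψ →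
          ∫ x, ⟪V₀ x, curl ψ x⟫_ℝ = ∫ x, ⟪curl V₀ x, ψ x⟫_ℝ) ∧
        (∃ x, x ≠ 0 ∧ curl V₀ x ≠ 0) ∧
        (∀ g ∈ G, ∀ x, x ≠ 0 → curl V₀ (g x) = g (curl V₀ x)) ∧
        (∀ x, curl V₀ (c • x) = (c ^ 2)⁻¹ • curl V₀ x) ∧
        (∀ g ∈ G, g ≠ 1 → ∀ e : EuclideanSpace ℝ (Fin 3), e ≠ 0 → g e = e → ∀ r : ℝ,
          (∃ μ : ℝ, V₀ (r • e) = μ • e) ∧ (r ≠ 0 → ∃ μ : ℝ, curl V₀ (r • e) = μ • e)) ∧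
        (∃ (v : ℝ → EuclideanSpace ℝ (Fin 3) → EuclideanSpace ℝ (Fin 3)) (π : ℝ → EuclideanSpace ℝ (Fin 3) → ℝ),
          IsLocalLeraySolution 1 V₀ v π ∧ IsDiscretelySelfSimilar c v) :=
  -- LANDED p170418 (lead c17, wave 3)
  _root_.Summit.NavierStokesRegularity.NavierStokesRegularity.Theorems.PolyhedralDssProfileExists.PolyhedralCell.stub_witnessPortraitIV

/-! ## Registered stubs of lead c17, wave 4 (N35, N38): no energy concentration at the singular time; criticality of the scar -/

/-- **Stub N35 — LANDED p170637 (M/L; worker): a Type-I singularity does not concentrate energy; its local dissipation is finite.** Let `V`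
be a Type-I ancient mild field in the Oseen gauge with `HasTypeIDecay C₀ V` and pointwise trace `V₀` off the origin. Then
for every `r > 0`: `∫_{B_r} ‖V(t) − V₀‖² → 0` as `t ↑ 0` (strong `L²_loc` convergence to the scar: the envelope
`4C₀²/|x|²` is integrable in `ℝ³`, dominated convergence), `‖V₀‖² ∈ L¹(B_r)`, and the space–time dissipation near the
singular point is finite, `∫_{−r²}^{0}∫_{B_r} ‖DV‖² < ∞` (`‖DV(t,x)‖ ≤ K₁/max(‖x‖,√(−t))²` by PV Lemma 7.1, and
`max(a,b)⁻⁴ ≤ a^{−5/2} b^{−3/2}`, `∫_{B_r}‖x‖^{−5/2} < ∞`, `∫_{−r²}^0 (−t)^{−3/4} dt < ∞`; Tonelli). Meaning: the local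
kinetic energy is continuous up to the blow-up time, `lim_{t↑0}∫_{B_r}|u(t)|² = ∫_{B_r}|V₀|²` — a Type-I DSS blow-up is
NOT an energy-concentration scenario, and `(u, p)` has finite local energy and dissipation around `(0,0)` (the CKN
singular set is the single point `(0,0)`).
[sources: CKN1982 (suitable weak solutions); PineauVicol2026 Lemma 7.1 (tree); folklore (DCT); tree StubBlowupTrace, StubTraceWeakLimit] -/
theorem stub_noEnergyConcentration :
    ∀ (V : ℝ → EuclideanSpace ℝ (Fin 3) → EuclideanSpace ℝ (Fin 3)) (C C₀ : ℝ)
      (V₀ : EuclideanSpace ℝ (Fin 3) → EuclideanSpace ℝ (Fin 3)),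
      IsTypeIAncientMild C V → HasTypeIDecay C₀ V →
      (∀ x, x ≠ 0 → Tendsto (fun t => V t x) (𝓝[<] 0) (𝓝 (V₀ x))) →
      (∀ r : ℝ, 0 < r →
        Tendsto (fun t => ∫ x in Metric.ball (0 : EuclideanSpace ℝ (Fin 3)) r, ‖V t x - V₀ x‖ ^ 2) (𝓝[<] 0) (𝓝 0)) ∧
      (∀ r : ℝ, 0 < r → IntegrableOn (fun x => ‖V₀ x‖ ^ 2) (Metric.ball (0 : EuclideanSpace ℝ (Fin 3)) r) volume) ∧
      (∀ r : ℝ, 0 < r →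
        (∫⁻ z in Set.Ioo (-r ^ 2) 0 ×ˢ Metric.ball (0 : EuclideanSpace ℝ (Fin 3)) r,
            ‖fderiv ℝ (V z.1) z.2‖ₑ ^ 2) < ⊤) :=
  -- LANDED p170637 (lead c17, wave 4)
  _root_.Summit.NavierStokesRegularity.NavierStokesRegularity.Theorems.PolyhedralDssProfileExists.PolyhedralCell.stub_noEnergyConcentration

/-- **Stub N38 — LANDED p170686 (M; worker): the scar is a genuinely CRITICAL object — unbounded at the origin, not in `L³` near it, yet
in weak-`L³` and in `L²_loc`.** Let `V₀` be continuous off the origin, a.e.-strongly measurable, with `V₀ 0 = 0`,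
`‖x‖‖V₀ x‖ ≤ C₀`, DSS-homogeneous `V₀(cx) = c⁻¹V₀(x)` (`c > 1`) and not identically zero. Then `V₀` is unbounded on
every punctured ball at `0`; `‖V₀‖³` is NOT integrable on `B₁` (the `L³` mass of each shell `{c^{−k−1} ≤ |x| < c^{−k}}` is
the same positive number — `L³(ℝ³)` is scale invariant — and there are infinitely many shells); but `V₀ ∈ L^{3,∞}`
(`{σ < |V₀|} ⊆ B̄_{C₀/σ}`) and `‖V₀‖² ∈ L¹(B_r)` for every `r`. Proof route: unboundedness from `V₀(c^{−k}x₀) = cᵏV₀(x₀)`;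
non-integrability via `Measure.addHaar_smul` / `MeasureTheory.integral_comp_smul` on the shells and positivity of the
integral of a continuous nonzero function on an open set; weak-`L³` as in N32's helper `scarForwardDss_memWeakLp`
(p169703); `L²_loc` from the envelope `C₀²‖x‖⁻²` (`integrableOn_ball_norm_rpow_neg`). Meaning: the scar sits exactly in
`L^{3,∞} ∖ L³` at the singular point — the borderline the ESS `L³` theory cannot see.
[sources: EscauriazaSereginSverak2003 (L³ criticality); BradshawTsai2017 (L^{3,∞} DSS data); folklore; tree StubScarForwardDss (p169703)] -/
theorem stub_scarCritical :
    ∀ (V₀ : EuclideanSpace ℝ (Fin 3) → EuclideanSpace ℝ (Fin 3)) (C₀ c : ℝ),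
      ContinuousOn V₀ {x | x ≠ 0} → AEStronglyMeasurable V₀ volume → V₀ 0 = 0 →
      (∀ x, ‖x‖ * ‖V₀ x‖ ≤ C₀) → 1 < c → (∀ x, V₀ (c • x) = c⁻¹ • V₀ x) → (∃ x, V₀ x ≠ 0) →
      (∀ M : ℝ, ∃ x : EuclideanSpace ℝ (Fin 3), x ≠ 0 ∧ ‖x‖ < 1 ∧ M < ‖V₀ x‖) ∧
      ¬ IntegrableOn (fun x => ‖V₀ x‖ ^ 3) (Metric.ball (0 : EuclideanSpace ℝ (Fin 3)) 1) volume ∧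
      Literature.Analysis.FunctionSpaces.MemWeakLp V₀ 3 volume ∧
      (∀ r : ℝ, 0 < r → IntegrableOn (fun x => ‖V₀ x‖ ^ 2) (Metric.ball (0 : EuclideanSpace ℝ (Fin 3)) r) volume) :=
  -- LANDED p170686 (lead c17, wave 4)
  _root_.Summit.NavierStokesRegularity.NavierStokesRegularity.Theorems.PolyhedralDssProfileExists.PolyhedralCell.stub_scarCritical

/-! ## Composition (kernel-checked; no `sorry` in the closure of `PolyhedralDssProfileExists_of`) -/

/-- **Composition: the ONE remaining stub — the ∃-cell — implies the crux `QuantisedSymmetry.PolyhedralDssProfileExists` BY NAME.**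
Hypothesis keyed by the registered stub name (`Registered.stub_polyhedralCellExists`, `rfl`-equal to the
literal stub signature); the proof is the LANDED reduction `stub_profileOfPolyhedralCell` (p152884), which
assembles the landed bridge stubs 2a–2d with Chae–Wolf 2017 Thm 1.1 and the KNSS gauge. So
`PolyhedralDssProfileExists ⇐ PolyhedralCellExists` is a tree theorem: the crux IS the existence of one
polyhedral cell. The witness is the concatenated field `u` of stub 2a, glued by stub 2b, classical by
stub 2d, `C_t L⁴` by stub 2c; its Type-I bound is Chae–Wolf 2017 Thm 1.1 at `q = 4` (tree theorem
`chaeWolf2017_dss_typeI_decay_of_lt_nine`), its duality-mildness the KNSS gauge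
`IsTypeIAncientMild.isAncientMildSolution`. -/
theorem PolyhedralDssProfileExists_of (h₁ : Registered.stub_polyhedralCellExists) :
    _root_.Summit.NavierStokesRegularity.NavierStokesRegularity.Theses.QuantisedSymmetry.PolyhedralDssProfileExists :=
  _root_.Summit.NavierStokesRegularity.NavierStokesRegularity.Theorems.PolyhedralDssProfileExists.PolyhedralCell.stub_profileOfPolyhedralCell
    h₁

/-! ## Wiring check -/

/-- A local copy of the crux (so that exactly ONE theorem of this file concludes the crux constant itself). -/
def PolyhedralDssProfileExists' : Prop :=
  _root_.Summit.NavierStokesRegularity.NavierStokesRegularity.Theses.QuantisedSymmetry.PolyhedralDssProfileExists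

/-- The sorried stubs, with their LITERAL signatures, feed `PolyhedralDssProfileExists_of` exactly as
stated (this declaration inherits the one remaining `sorry` through it; `PolyhedralDssProfileExists_of` itself
is closed: axioms `propext, Classical.choice, Quot.sound`). -/
theorem polyhedralDssProfileExists_of_stubs : PolyhedralDssProfileExists' :=
  PolyhedralDssProfileExists_of stub_polyhedralCellExists

end Summit.NavierStokesRegularity.NavierStokesRegularity.Cruxes.PolyhedralDssProfileExists.PolyhedralCell

end
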